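import Summits.AtomisticToContinuum.FouriersLaw.Theses.EmbeddedDrudeMourre
import Summits.AtomisticToContinuum.FouriersLaw.Theorems.EmbeddedDrudeMourreMourreDissolutionOfKineticCorner
import Summits.AtomisticToContinuum.FouriersLaw.Theorems.KineticCornerStationaryCorrelationBound
import Summits.AtomisticToContinuum.FouriersLaw.Theorems.EmbeddedDrudeMourreFGRGap
import Summits.AtomisticToContinuum.FouriersLaw.Theorems.DrudeDissolution.Negative.SpectralPairNecessities
import Summits.AtomisticToContinuum.FouriersLaw.Theorems.DrudeDissolution.Negative.WindowNotL1
import Literature.MathematicalPhysics.KineticTheory.ZeroWavenumberSpace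
import Summits.AtomisticToContinuum.FouriersLaw.Theorems.EmbeddedDrudeMourreDrudeDissolutionStubDilutePolymerGasSum
import Summits.AtomisticToContinuum.FouriersLaw.Theorems.EmbeddedDrudeMourreDrudeDissolutionStubLatticeGreenKubo
import Summits.AtomisticToContinuum.FouriersLaw.Theorems.EmbeddedDrudeMourreDrudeDissolutionStubRichFramework
import Summits.AtomisticToContinuum.FouriersLaw.Theorems.EmbeddedDrudeMourreMourreDissolutionLevelShiftPushforward
import Summits.AtomisticToContinuum.FouriersLaw.Theorems.EmbeddedDrudeMourreDrudeDissolutionStubIntegrableOnCosTransformOfSecondDifference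
import Summits.AtomisticToContinuum.FouriersLaw.Theorems.EmbeddedDrudeMourreDrudeDissolutionStubExcursionIntegralFGR
import Summits.AtomisticToContinuum.FouriersLaw.Theorems.EmbeddedDrudeMourreDrudeDissolutionStubExcursionKernelPushforward
import Summits.AtomisticToContinuum.FouriersLaw.Theorems.EmbeddedDrudeMourreDrudeDissolutionStubExcursionSecondDifferenceCubeAssembly
import Summits.AtomisticToContinuum.FouriersLaw.Theorems.EmbeddedDrudeMourreDrudeDissolutionCutoffSupFamily

/-!
# Line `kinetic-polymer-gas-on-the-time-axis` — checked skeleton for the crux `EmbeddedDrudeMourre.DrudeDissolution`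
(stmt-AtomisticToContinuum-12593, rank-0 target / auto-crux of route `route-AtomisticToContinuum-EmbeddedDrudeMourre`,
sub-problem `AtomisticToContinuum/FouriersLaw`; crux-plan round 1, gen 1;
planner `planner-cruxplan-stmt-AtomisticToContinuum-12593-kinetic-polymer-gas--0`, 2026-08-16)

Crux (FIXED — the route decl, never restated): for `pinnedChain ω₂ lam β γ` (all four `> 0`) there is `T₀ > 0` such
that for every `T ∈ (0, T₀)` some Gibbs state `μ_T` with a `μ_T`-preserving infinite-volume dynamics `D` (absolutely
convergent current correlations) has `C_T(t) = Σ_x ∫ j_0 (j_x ∘ φ_t) dμ_T = ∫ cos(ωt) dσ(ω)` for a finite measure `σ`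
carrying, on a window `(-δ, δ)`, a continuous density `g ≥ 0` with `g 0 > 0`.

Idea card `Cruxes/DrudeDissolution/Ideas/kinetic-polymer-gas-on-the-time-axis.md` (crux-ideate r1, ideator 2); triage
r1-1 / r1-2 / r1-3: pass ×3 (mandatory repair "symmetric σ" — discharged below by the LANDED integrable-spectral
criterion; sharpenings (a) Kotecký–Preiss margin against the on-site floor, (b) one-step Markov property as its own
stub, (c) (j,n) pair channel as a declared species, (d) drop `+iΛ` on the odd sector — all acted on, see the line card
`Lines/kinetic-polymer-gas-on-the-time-axis.md`). Previous line of this crux: `Lines/Sketch.lean` (DEAD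
`blocked-on-open`, `Lines/Sketch-dead.md`: its two open stubs PKT∃/KL∃ were the whole research-open time-domain core
with no named engine). THIS line names the engine and types it: De Roeck–Kupiainen's polymer gas on the time axis.

## The line in one paragraph

Work in Doyon's zero-wavenumber Hilbert space `ℋ₀(μ_T)` of a RICH datum over the Buttà–Marchioro dynamics (Stub F),
where `C_T(t) = ⟪[J], U_t [J]⟫₀`. Compress the Koopman group to a closed subspace `K ∋ [J]` (intended: the closure of the
ODD ONE-PHONON CHARGES `Σ_n c_n q_0 (p_n − p_{−n})` plus `[J]`; `P = P_K`), and sample on the KINETIC LATTICE `t ∈ νℕ`,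
`ν = T⁻²` (De Roeck–Kupiainen arXiv:1005.1080 §1.7, §2: `t = Nν`, `ν = ℓλ⁻²`, `ℓ = 1`). The exact one-step reduced map
`T = P U_ν P` is DISSIPATIVE, `‖Tⁿ‖ ≤ C(1−g)ⁿ` (DK Assumption 2.3 with `R = 0`: on odd charges the Markov/kinetic
approximation `T ≈ e^{−L̂_odd}` has NO eigenvalue `1`, the monomer generator being symmetric (triage r1-3 §E4(a): no
`+iΛ`) and gapped — `H = HasOddSectorGap` enters HERE, through the one-step contraction Stub D); the corrections to
`T^N` form a POLYMER GAS ON THE TIME AXIS, `P U_{Nν+s} P − (P U_s P) Tᴺ = Σ_{polymer configurations} 𝒯[⋯]` (DK (2.12)),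
whose connected excursion activities obey DK's Assumption 2.2 with a smallness `δ → 0` as `T → 0` (the bet, Stub M;
its free input — DK's Assumption 1.2 "∫₀^∞ h < ∞" — is the time-integrability of the free odd excursion kernel on the
`(2,2)` zero-momentum shell, whose time integral IS ALS's collision form by the Fermi golden rule: Stub B). The abstract
summation theorem (Stub A: `Σ_N ‖Z_N − X Tᴺ‖ ≤ 8Cδ/g²` for `δ ≤ g/4`, elementary because EVERY `T`-string decays — no
Feynman rule / Ward identity is needed when `R = 0`) and a lattice-to-continuum Green–Kubo lemma (Stub E) then give
`C_T ∈ L¹(0,∞)` with `∫₀^∞ C_T ≥ p₀ − ν·‖[J]‖²·8Cδ/g² ≥ p₀/2 > 0` (Markov plateau `p₀` from M(iii), `‖[J]‖² ≤ B T²` from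
the LANDED `currentVariance_le`), and the LANDED cosine-Bochner theorem + integrable-spectral criterion
(`stub_cosineBochner`, `stub_integrableSpectralCriterion`, which symmetrises `σ` — triage's mandatory repair) produce
the window density, positive at `0`. Output is MORE than the crux (`C_T ∈ L¹`; Disproof §5 shows the crux does not force
it) — the card's Transfer C⁺, deliberately.

Composition `DrudeDissolution_of : DrudeDissolution` is kernel-checked: no `sorry` outside the six `stub_*`, all six used
BY NAME (audit: `support … used by DrudeDissolution_of`), the crux concluded BY NAME. Order of choices (certified by the
proof): `(C, g, p₀)` from M ← (H, B, D); `B` from `currentVariance_le`; `δ := min (g/4) (p₀g²/(16 B⁺ C))`; `T₀ := min` of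
the three thresholds; at `T < T₀`: datum from F, `(K, act, Ptot)` from M, Stub A per partial step `s ∈ [0, ν)`, Stub E.

## Disproof.lean used (cdisprove cycle 1 final, 2026-08-16T06:13Z; landed Negative lemmas imported above and compiled
## against: `Negative.SpectralPairNecessities`, `Negative.WindowNotL1`; `Negative.WeakAnharmonicityForm` via §3d)

* `drudeDissolution_false_without_temp_pos` (§3a, the only `_false_without_` theorem): every stub keeps `0 < T`.
* §4 harmonic endpoint (`hasDerivAt_bondCurrentZ_harmonic`, near-miss `harmonic_no_spectralWitness`): `lam, β > 0` is
  load-bearing — honoured VISIBLY: `H = HasOddSectorGap ω₂ lam β` (false at `lam = β = 0`, where `vertex ≡ 0`) is used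
  at Stub D (the monomer contracts) and threaded into Stub M; Stub B's kernel vanishes identically at `a = b = 0`, so
  the gas has no dilution parameter there: the line dies at the harmonic point, as it must (the Drude atom).
* §3d (`drudeDissolution_iff_weak_anharmonicity`): the lattice spacing `ν = T⁻²` IS the `ε⁻²` kinetic scale of the
  unit-temperature normal form; all constants `C, g, p₀, θ` are `T`-independent, only `δ(T) → 0`.
* §2 necessities (`tendsto_cesaro_zero_of_window`, `atom_eq_zero_of_window`, Mazur handle `not_window_of_floor`): the
  line outputs `C_T ∈ L¹(0,∞)`, which implies them; an odd conserved charge overlapping `[J]` makes Stub D false (no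
  contraction) — the line fails loudly, it cannot certify a false dissolution.
* §5 (`exists_window_not_integrable`, landed `Negative.WindowNotL1`): the line knowingly proves the STRONGER `L¹`
  statement (card Transfer C⁺; MD-consistent, KitResults-ideator2.md); no stub is an instance that lemma refutes.
* §3c junk inhabitants (`laxSpectralWitness_all`, `not_identity_flow`): excluded structurally — BM carrier `bmGood`,
  DLR clause, `P U_ν P` dissipative (the identity flow has `‖Tⁿ‖ = 1`).
-/

noncomputable section

open MeasureTheory Set Filter Topology Function Real
open scoped InnerProductSpace ENNReal BigOperators
open Literature.MathematicalPhysics.KineticTheory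
open Literature.MathematicalPhysics.KineticTheory.HeatConduction
open Literature.MathematicalPhysics.KineticTheory.PhononBoltzmann

namespace Summit.AtomisticToContinuum.FouriersLaw.Cruxes.DrudeDissolution.KineticPolymerGasOnTheTimeAxis

/-! LEAD c13 (2026-08-17, skeleton v5): B1a p150259, B2 p150563, B1c″ p151030 LANDED and wired in below (sorries 6 → 3:
B1b″ `stub_excursionSecondDifference` (the real-analysis wall, in progress), D, M (research-open core)).
v4: B1a `stub_excursionKernelPushforward` and B2 `stub_excursionIntegralFGR`
PROVED (corollaries of lead c11's landed `freeOddExcursionKernel_eq_cosTransform` /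
`integral_freeOddExcursionKernel_of_integrableOn`; landing as `--supports` files
`Theorems/EmbeddedDrudeMourreDrudeDissolutionStub{ExcursionKernelPushforward,ExcursionIntegralFGR}.lean`, then
imported here); B1b/B1c RESHAPED to the second-difference (Besov `B^{1+α}_{1,∞}`) form — weakest hypothesis on the
density `h` of `m_f` that gives `F_f = O(t^{−1−α})`, no derivative named; open stubs: B1b (lead, XL), B1c (worker,
S–M), D, M (research-open core). -/

/-! LEAD c13 (2026-08-17, skeleton v4): the real-analysis wall B1 (`F_f ∈ L¹(dt)`) RESHAPED from the density form
(v3: B1b `stub_excursionDensityRegular` — everywhere-differentiable global density with Hölder-`L¹` derivative — and B1c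
`stub_integrableOn_cosTransform_of_regular`) to the DUAL SECOND-DIFFERENCE form: B1b″ `stub_excursionSecondDifference`
(`|∫ (2φ(x) − φ(x+δ) − φ(x−δ)) dm_f(x)| ≤ C δ^{1+α}` for `C²` test functions `|φ| ≤ 1`; no density, no coarea, no
stationary phase: integration by parts along a transversal coordinate on charts with a gradient floor, δ-dependent tubes
around the explicit critical set of `Ω`, dyadic power counting) and B1c″ `stub_integrableOn_cosTransform_of_secondDifference`
(the translation trick `φ = cos(t·)`, `δ = π/t`: `2φ − φ(·+δ) − φ(·−δ) = 4φ`, so `|F(t)| ≤ (C/4)(π/t)^{1+α}`). B1a, B2 are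
corollaries of landed lemmas (p140460, p140313) and land as `--supports`; D, M unchanged (research-open core). -/

/-! LEAD c12 (2026-08-17, skeleton v3 = THE REGISTERED SKELETON of the crux from this lead on): line PICKED
(`Cruxes/DrudeDissolution/PICKED.md`); B `stub_freeOddExcursionKernel` RESHAPED into the registered sub-stubs B1a
`stub_excursionKernelPushforward`, B1b `stub_excursionDensityRegular` (lead; the real-analysis wall of B), B1c
`stub_integrableOn_cosTransform_of_regular`, B2 `stub_excursionIntegralFGR` and PROVED from them below (statement
byte-identical); open stubs: B1a, B1b, B1c, B2 (provable), D, M (the research-open core, held, not re-dressed). -/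

/-! LEAD a1 INTEGRATION (2026-08-17, skeleton v2, published to `Lines/` but NOT the registered skeleton — the
registered line is gram-pencil-harmonic-chaos): the three provable stubs of this line have LANDED as `--supports`
files under `Summits/…/Theorems/EmbeddedDrudeMourreDrudeDissolutionStub{DilutePolymerGasSum,LatticeGreenKubo,RichFramework}.lean`
(A p137406, E p137133, F p138890 — F for EVERY `T > 0`, localObs = the algebra generated by the flow-orbit of the
local polynomials) and are wired in below; `sorry` remains only in B `stub_freeOddExcursionKernel` (harmonic-lattice
stationary phase + FGR identity; true, XL as formalisation), D `stub_oneStepContraction` (one-step kinetic limit, XL/open)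
and M `stub_oddSectorMarkovGas` (the bet, open). -/

/-! ## Stub A — abstract: a dilute DISSIPATIVE polymer gas on the time axis is summable (De Roeck–Kupiainen, `R = 0`) -/

/-- **Stub A — the abstract De Roeck–Kupiainen summation theorem in the dissipative case `R = 0`** (pure normed-ring
combinatorics; PROVABLE NOW, size M–L). In a real normed ring `R` (here: `B(ℋ₀)`) let `T` ("monomer", the one-step
reduced map), `X` (the final partial step) and legs `act N A ι τ ∈ R` be given, and suppose
(dissipativity, DK Ass. 2.3 with NO unit eigenvalue) `‖Tⁿ‖ ≤ C(1−g)ⁿ`, `‖X‖ ≤ 1`, `1 ≤ C`, `0 < g < 1`;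
(summable activities, DK Ass. 2.2 with `ζ ≡ 1` and Kotecký–Preiss weight `r^{|A|}`, `r = C/(1−g)`) for every `N` and
every anchor `τ₀`: `Σ_{(A,ι) : A ⊆ {1..N+1}, |A| ≥ 2, max A = τ₀} r^{|A|} Π_{τ∈A} ‖act N A ι τ‖ ≤ δ` (an `ℝ≥0∞`-valued
sum: no junk); (polymer representation, DK (2.12)) `Z N − X Tᴺ = Σ` over non-empty collections `𝒞` of polymers
`(A, ι)` with pairwise disjoint supports of the time-ordered product over slots `N+1, N, …, 1` (slot `N+1` carries `X`,
slots `≤ N` carry `T`, a slot in the support of `(A,ι) ∈ 𝒞` carries its leg). THEN for `δ ≤ g/4`: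
`Σ_N ‖Z N − X Tᴺ‖ ≤ 8Cδ/g²`. Proof (planner notes, elementary because EVERY `T`-string decays, so DK's Feynman rule /
Ward identity §2.3 is not needed): per configuration `‖term‖ ≤ C(1−g)ᴺ Π_{p∈𝒞} a(p) r^{|A_p|}` (sub-multiplicativity;
`#T-runs ≤ #leg-slots + 1`); `Σ_{𝒞 ≠ ∅} Π w ≤ e^{W} − 1`, `W = Σ_p w(p) ≤ (N+1)δ`; hence
`‖Z N − X Tᴺ‖ ≤ C(1−g)ᴺ(e^{(N+1)δ} − 1)` and `Σ_N ≤ C[e^δ/(1−(1−g)e^δ) − 1/g] ≤ 8Cδ/g²` when `δ ≤ g/4`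
(`e^δ ≤ 1+2δ`, denominator `≥ g/2`). Mathlib only. [cite: DeRoeckKupiainen2011, arXiv:1005.1080 §2.2 eq. (2.12),
Ass. 2.2–2.3, Thm 2.4; KoteckyPreiss1986, doi:10.1007/bf01211762] -/
theorem stub_dilutePolymerGasSum :
    ∀ (R : Type*) [NormedRing R] (T X : R) (Z : ℕ → R) (act : ℕ → Finset ℕ → ℕ → ℕ → R)
      (C g δ : ℝ), 1 ≤ C → 0 < g → g < 1 → 0 ≤ δ → δ ≤ g / 4 →
      (∀ n : ℕ, ‖T ^ n‖ ≤ C * (1 - g) ^ n) → ‖X‖ ≤ 1 →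
      (∀ N τ₀ : ℕ,
        (∑' p : {p : Finset ℕ × ℕ // p.1 ⊆ Finset.Icc 1 (N + 1) ∧ 2 ≤ p.1.card ∧ p.1.max = ↑τ₀},
          ENNReal.ofReal ((C / (1 - g)) ^ p.1.1.card * ∏ τ ∈ p.1.1, ‖act N p.1.1 p.1.2 τ‖))
          ≤ ENNReal.ofReal δ) →
      (∀ N : ℕ, HasSum
        (fun 𝒞 : {𝒞 : Finset (Finset ℕ × ℕ) // 𝒞.Nonempty ∧
            (∀ p ∈ 𝒞, p.1 ⊆ Finset.Icc 1 (N + 1) ∧ 2 ≤ p.1.card) ∧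
            (𝒞 : Set (Finset ℕ × ℕ)).PairwiseDisjoint Prod.fst} =>
          ((List.range (N + 1)).map (fun i : ℕ =>
            if (𝒞.1.filter (fun p => N + 1 - i ∈ p.1)) = ∅ then (if i = 0 then X else T)
            else ∑ p ∈ 𝒞.1.filter (fun p => N + 1 - i ∈ p.1), act N p.1 p.2 (N + 1 - i))).prod)
        (Z N - X * T ^ N)) →
      Summable (fun N : ℕ => ‖Z N - X * T ^ N‖) ∧
        ∑' N : ℕ, ‖Z N - X * T ^ N‖ ≤ 8 * C * δ / g ^ 2 :=
  Summit.AtomisticToContinuum.FouriersLaw.Theorems.DrudeDissolution.KineticPolymerGasOnTheTimeAxis.stub_dilutePolymerGasSum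

/-! ## Stub E — abstract: the lattice-to-continuum Green–Kubo lemma -/

/-- **Stub E — lattice-to-continuum Green–Kubo lemma** (pure real analysis; PROVABLE NOW, size M). If a continuous
`C : ℝ → ℝ` is, on every cell `[Nν, (N+1)ν)` of a lattice of spacing `ν > 0`, close to continuous "main terms"
`m N : ℝ → ℝ` in the summed sense `Σ_N |C(Nν+s) − m N s| ≤ Etot` for every offset `s ∈ [0, ν)` (summability part of
the hypothesis), the main terms are themselves summable `Σ_N |m N s| ≤ Mtot`, and `Σ_N ∫₀^ν m N = Ptot`, then
`C ∈ L¹(0, ∞)` and `|∫₀^∞ C − Ptot| ≤ ν·Etot`. Proof: `(0,∞) = ⋃_N [Nν,(N+1)ν)` a.e.; Tonelli on each cell after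
`t = Nν + s`: `∫₀^∞ |C| ≤ ∫₀^ν Σ_N (|m N s| + |C(Nν+s) − m N s|) ds ≤ ν(Mtot + Etot)`
(`MeasureTheory.integrableOn_iUnion_of_summable_integral_norm`); then `∫₀^∞ C = Σ_N ∫₀^ν C(Nν+·)`
(`MeasureTheory.integral_iUnion`) and `|Σ_N ∫₀^ν (C(Nν+s) − m N s) ds| ≤ ∫₀^ν Σ_N |…| ≤ ν Etot`. In the composition
`C = C_T`, `ν = T⁻²`, `m N s = ⟪[J], (P U_s P)(P U_ν P)ᴺ [J]⟫`, `Etot = ‖[J]‖²·8Cδ/g²` (Stub A), `Mtot = ‖[J]‖²C/g`,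
`Ptot` = the Markov plateau of Stub M(iii). Mathlib only. [folklore] -/
theorem stub_latticeGreenKubo :
    ∀ (Cf : ℝ → ℝ) (m : ℕ → ℝ → ℝ) (ν Etot Mtot Ptot : ℝ), 0 < ν →
      Continuous Cf → (∀ N : ℕ, Continuous (m N)) →
      (∀ s ∈ Set.Ico (0 : ℝ) ν, Summable (fun N : ℕ => |Cf (N * ν + s) - m N s|) ∧
        ∑' N : ℕ, |Cf (N * ν + s) - m N s| ≤ Etot) →
      (∀ s ∈ Set.Ico (0 : ℝ) ν, Summable (fun N : ℕ => |m N s|) ∧ ∑' N : ℕ, |m N s| ≤ Mtot) →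
      HasSum (fun N : ℕ => ∫ s in (0 : ℝ)..ν, m N s) Ptot →
      IntegrableOn Cf (Set.Ioi 0) ∧ |(∫ t in Set.Ioi (0 : ℝ), Cf t) - Ptot| ≤ ν * Etot :=
  Summit.AtomisticToContinuum.FouriersLaw.Theorems.DrudeDissolution.KineticPolymerGasOnTheTimeAxis.stub_latticeGreenKubo

/-! ## Stub B — the free odd excursion kernel is integrable in time; its time integral is ALS's collision form

LEAD c13 RESHAPE (skeleton v4, 2026-08-17): B1b/B1c of v3 replaced by B1b″ `stub_excursionSecondDifference` /
B1c″ `stub_integrableOn_cosTransform_of_secondDifference` (dual second-difference form; see the docstrings); the v3 text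
below is kept for the record.

LEAD c12 RESHAPE (skeleton v3, 2026-08-17). B `stub_freeOddExcursionKernel` is no longer a stub: it is PROVED below
from four registered sub-stubs —
* B1a `stub_excursionKernelPushforward` (measure-theoretic plumbing, M): the cube integral `F_f(t) = ∫_{cell³} W cos(tΩ)`
  is the cosine transform `∫ cos(tx) dm_f(x)` of the FINITE pushforward measure `m_f = Ω_*(W dk)` of the sibling crux
  12594 (`MourreDissolution.stub_levelShiftPushforward`, same expression verbatim: cell read at `p = (k₁,(k₃,k₂))`);
* B1b `stub_excursionDensityRegular` (THE REAL-ANALYSIS WALL of B, XL, lead; lead c13 reshape to the weakest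
  sufficient form): `m_f` has a GLOBAL integrable density `h ≥ 0` whose second differences are Hölder-small in `L¹`,
  `∫|h(x+δ) − 2h(x) + h(x−δ)|dx ≤ Cδ^{1+α}` (Besov `B^{1+α}_{1,∞}`; holds iff `h` is continuous at the finitely many
  critical values of `Ω` on `𝕋³` — the co-moving curves inside the exchange planes `{k₃=k₁} ∪ {k₃=k₂}`, all at level
  `0`, where the bracket kills the amplitude to 2nd/4th order, plus the two isolated extrema `(0,0,π)`, `(π,π,0)` at
  `∓E_c = ∓2(ω(π)−ω(0))`; local models `smooth + E² log|E|`, `E² log²|E|` at `0`, `(E_c ∓ E)^{5/2}` at the edges);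
* B1c `stub_integrableOn_cosTransform_of_regular` (generic real analysis, S–M; lead c13 reshape): such a density has
  a cosine transform in `L¹(0,∞)` — the translations `x ↦ x ± π/t` flip the sign of `cos(tx)`, so
  `4F(t) = ∫cos(tx)(2h(x) − h(x+π/t) − h(x−π/t))dx`, `|F(t)| ≤ (C/4)π^{1+α} t^{−1−α}`, and `|F(t)| ≤ ‖h‖₁` near `t = 0`;
* B2 `stub_excursionIntegralFGR` (Abel + Fubini + the LANDED Fermi golden rule at the threshold, M): for any
  `F ∈ L¹(0,∞)` with `F(t) = ∫cos(tx)dm_f(x)`: `∫₀^∞ F = lim_{ν↓0} ∫₀^∞ e^{−νt}F(t)dt` (dominated convergence)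
  `= lim_{ν↓0} ∫ ν/(ν²+x²) dm_f(x)` (Fubini, `∫₀^∞ e^{−νt}cos(tx)dt = ν/(ν²+x²)`) `= lim_{ν↓0} R_f(ν,0)`
  (`stub_levelShiftPushforward` at `E = 0`) `= (4π/alsPrefactor)·q(f)` (`fermiGoldenRule_threshold`) `= (64π²/9)·q(f)`
  (`alsPrefactor = 9/(16π)`).
The statement of B is byte-identical to v2 (M consumes it by name). -/

/-- **Stub B1a — `stub_excursionKernelPushforward` (PROVABLE NOW, size M; pure measure theory).** For `ω₂ > 0`,
couplings `a, b`, a continuous profile `f` and every `t`, the bracket-weighted free pair kernel written as an integral over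
the cube `Set.pi univ (Ioc (-π) π) ⊆ (Fin 3 → ℝ)` (variables `(k 0, k 1, k 2) = (k₁, k₂, k₃)`) equals the cosine transform
`∫ cos(t x) dm_f(x)` of the pushforward `m_f = Ω_*(W dk)` of the sibling crux, whose cell is the iterated product read at
`p = (k₁, (k₃, k₂))`. Proof: transport `volume` on `Fin 3 → ℝ` restricted to the cube to the iterated product
(`Measure.restrict_pi_pi`/`volume_pi`, `MeasureTheory.measurePreserving_piFinSuccAbove` twice + `volume_preserving_funUnique`,
or `MeasurableEquiv.piFinSuccAbove`/`finTwoArrow` bookkeeping, and the swap `(k₂,k₃) ↦ (k₃,k₂)` by `Measure.prod_swap`), then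
`MourreDissolution.levelShift_integral_map_withDensity` (landed) with `P = cos(t·)`. [folklore] -/
theorem stub_excursionKernelPushforward :
    ∀ ω₂ a b : ℝ, 0 < ω₂ → ∀ f : ℝ → ℝ, Continuous f → ∀ t : ℝ,
      (∫ k in Set.pi Set.univ (fun _ : Fin 3 => Set.Ioc (-π) π),
          vertex a b (k 0) (k 1) (k 2) ^ 2 *
            (f (k 0) + f (k 1) - f (k 2) - f (k 0 + k 1 - k 2)) ^ 2 /
            (dispersion ω₂ (k 0) * dispersion ω₂ (k 1) * dispersion ω₂ (k 2) *
              dispersion ω₂ (k 0 + k 1 - k 2)) ^ 2 *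
            Real.cos (t * resonanceFn ω₂ (k 0) (k 1) (k 2))) =
        ∫ x, Real.cos (t * x) ∂(MeasureTheory.Measure.map (fun p : ℝ × ℝ × ℝ => resonanceFn ω₂ p.1 p.2.2 p.2.1)
            (((volume.restrict (Set.Ioc (-Real.pi) Real.pi)).prod
                ((volume.restrict (Set.Ioc (-Real.pi) Real.pi)).prod
                  (volume.restrict (Set.Ioc (-Real.pi) Real.pi)))).withDensity
              (fun p : ℝ × ℝ × ℝ => ENNReal.ofReal
                (vertex a b p.1 p.2.2 p.2.1 ^ 2 /
                    (dispersion ω₂ p.1 * dispersion ω₂ p.2.2 * dispersion ω₂ p.2.1 *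
                      dispersion ω₂ (p.1 + p.2.2 - p.2.1)) ^ 2 *
                  (f p.1 + f p.2.2 - f p.2.1 - f (p.1 + p.2.2 - p.2.1)) ^ 2)))) :=
  Summit.AtomisticToContinuum.FouriersLaw.Theorems.DrudeDissolution.KineticPolymerGasOnTheTimeAxis.stub_excursionKernelPushforward

/-- **Stub C6 — `stub_supBoundPackage` (skeleton v7: PROVED — `cutoff_sup_family` p160389, twin process B; was the last open piece of B1b″).** For the concrete data of B1b″ (free functions with defining
hypotheses, the twin files' convention: sine polynomial `f`, half-angle sines `S₁ S₂`, sheet amplitude `A = 8H/Q`, excursion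
weight `W`, `D = |∇Ω|²`, fluxes `Xⱼ = ∂ⱼΩ/D` for `Ω = resonanceFn` on the cell): constants `K ≥ 0`, `0 < η₀ ≤ 1` and, for
every `0 < η ≤ η₀`, a `C²` cutoff `Θ` with the properties of the LANDED `exists_cutoff_family` (p159253: values in `[0,1]`,
`2π`-periodic, `≡ 0` near `{some ρₖ < η²}`, `= 1` on `{all ρₖ ≥ 4η²}`) whose double divergence obeys the SUP BOUND
`|Σⱼ ∂ⱼ(L_G Xⱼ)| ≤ K/η²`, `L_G = Σⱼ ∂ⱼ(W Θ Xⱼ)` (inputs all landed: gradient floors p158448/p157849, structure bounds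
p157743/p158458/p158640, cutoff arguments p158836, sup algebra p153922/p155268/p159175). With it, B1b″ below is a theorem
(`stub_excursionSecondDifference_of_supBound`, p159900). [folklore] -/
theorem stub_supBoundPackage :
    ∀ ω₂ a b : ℝ, 0 < ω₂ → ∀ (M : ℕ) (c : Fin M → ℝ) (f : ℝ → ℝ) (A S₁ S₂ W D X₁ X₂ X₃ : ℝ × ℝ × ℝ → ℝ),
        (∀ k, f k = ∑ i, c i * Real.sin (((i : ℕ) + 1 : ℕ) * k)) →
        (∀ p : ℝ × ℝ × ℝ, S₁ p = Real.sin ((p.2.1 - p.1) / 2)) →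
        (∀ p : ℝ × ℝ × ℝ, S₂ p = Real.sin ((p.2.1 - p.2.2) / 2)) →
        (∀ p : ℝ × ℝ × ℝ, A p =
          8 * ((dispersion ω₂ p.1 * dispersion ω₂ p.2.2 +
                  dispersion ω₂ p.2.1 * dispersion ω₂ (p.1 + p.2.2 - p.2.1) + 2 * (ω₂ + 2)) *
                Real.cos ((p.1 + p.2.2) / 2) -
              4 * Real.cos ((p.2.1 - p.1) / 2) * Real.cos ((p.2.2 - p.2.1) / 2)) /
            ((dispersion ω₂ p.1 + dispersion ω₂ p.2.2 + dispersion ω₂ p.2.1 + dispersion ω₂ (p.1 + p.2.2 - p.2.1)) *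
              (dispersion ω₂ p.1 * dispersion ω₂ p.2.2 +
                dispersion ω₂ p.2.1 * dispersion ω₂ (p.1 + p.2.2 - p.2.1)))) →
        (∀ p : ℝ × ℝ × ℝ, W p = vertex a b p.1 p.2.2 p.2.1 ^ 2 /
            (dispersion ω₂ p.1 * dispersion ω₂ p.2.2 * dispersion ω₂ p.2.1 * dispersion ω₂ (p.1 + p.2.2 - p.2.1)) ^ 2 *
          (f p.1 + f p.2.2 - f p.2.1 - f (p.1 + p.2.2 - p.2.1)) ^ 2) →
        (∀ q, D q = (fderiv ℝ (fun r : ℝ × ℝ × ℝ => resonanceFn ω₂ r.1 r.2.2 r.2.1) q (1, 0, 0)) ^ 2 +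
          (fderiv ℝ (fun r : ℝ × ℝ × ℝ => resonanceFn ω₂ r.1 r.2.2 r.2.1) q (0, 1, 0)) ^ 2 +
          (fderiv ℝ (fun r : ℝ × ℝ × ℝ => resonanceFn ω₂ r.1 r.2.2 r.2.1) q (0, 0, 1)) ^ 2) →
        (∀ q, X₁ q = fderiv ℝ (fun r : ℝ × ℝ × ℝ => resonanceFn ω₂ r.1 r.2.2 r.2.1) q (1, 0, 0) / D q) →
        (∀ q, X₂ q = fderiv ℝ (fun r : ℝ × ℝ × ℝ => resonanceFn ω₂ r.1 r.2.2 r.2.1) q (0, 1, 0) / D q) →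
        (∀ q, X₃ q = fderiv ℝ (fun r : ℝ × ℝ × ℝ => resonanceFn ω₂ r.1 r.2.2 r.2.1) q (0, 0, 1) / D q) →
        (∃ K η₀ : ℝ, 0 ≤ K ∧ 0 < η₀ ∧ η₀ ≤ 1 ∧ ∀ η : ℝ, 0 < η → η ≤ η₀ → ∃ Θ LG : ℝ × ℝ × ℝ → ℝ,
          ContDiff ℝ 2 Θ ∧ (∀ p, 0 ≤ Θ p ∧ Θ p ≤ 1) ∧
          (∀ q : ℝ × ℝ × ℝ, Θ (q + (2 * Real.pi, 0, 0)) = Θ q) ∧ (∀ q : ℝ × ℝ × ℝ, Θ (q + (0, 2 * Real.pi, 0)) = Θ q) ∧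
          (∀ q : ℝ × ℝ × ℝ, Θ (q + (0, 0, 2 * Real.pi)) = Θ q) ∧
          (∀ p : ℝ × ℝ × ℝ, (S₁ p ^ 2 + A p ^ 2 < η ^ 2 ∨ S₂ p ^ 2 + A p ^ 2 < η ^ 2 ∨ S₁ p ^ 2 + S₂ p ^ 2 < η ^ 2 ∨
              (1 - Real.cos p.1) + (1 - Real.cos p.2.2) + (1 + Real.cos p.2.1) < η ^ 2 ∨
              (1 + Real.cos p.1) + (1 + Real.cos p.2.2) + (1 - Real.cos p.2.1) < η ^ 2) → Θ =ᶠ[𝓝 p] 0) ∧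
          (∀ p : ℝ × ℝ × ℝ, 4 * η ^ 2 ≤ S₁ p ^ 2 + A p ^ 2 → 4 * η ^ 2 ≤ S₂ p ^ 2 + A p ^ 2 →
              4 * η ^ 2 ≤ S₁ p ^ 2 + S₂ p ^ 2 →
              4 * η ^ 2 ≤ (1 - Real.cos p.1) + (1 - Real.cos p.2.2) + (1 + Real.cos p.2.1) →
              4 * η ^ 2 ≤ (1 + Real.cos p.1) + (1 + Real.cos p.2.2) + (1 - Real.cos p.2.1) → Θ p = 1) ∧
          (∀ q, LG q = fderiv ℝ (fun r => W r * Θ r * X₁ r) q (1, 0, 0) +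
            fderiv ℝ (fun r => W r * Θ r * X₂ r) q (0, 1, 0) + fderiv ℝ (fun r => W r * Θ r * X₃ r) q (0, 0, 1)) ∧
          (∀ p, |fderiv ℝ (fun q => LG q * X₁ q) p (1, 0, 0) + fderiv ℝ (fun q => LG q * X₂ q) p (0, 1, 0) +
            fderiv ℝ (fun q => LG q * X₃ q) p (0, 0, 1)| ≤ K / η ^ 2)) :=
  -- skeleton v7 (lead c13): C6 LANDED by the twin process B as `cutoff_sup_family` (p160389; = exists_cutoff_family p159253 +
  -- supBound_pointwise p160191) — B1b″ is now sorry-free in the tree.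
  Summit.AtomisticToContinuum.FouriersLaw.Theorems.DrudeDissolution.KineticPolymerGasOnTheTimeAxis.cutoff_sup_family

/-- **Stub B1b″ — `stub_excursionSecondDifference` (skeleton v6: now a THEOREM of the skeleton modulo Stub C6 above; reshaped by lead c13; size XL but elementary; held
by the lead).** For `ω₂ > 0`, couplings `a, b` and an odd trigonometric-polynomial profile `f`, the bracket-weighted
two-phonon density of states `m_f = Ω_*(W dk)` (the finite pushforward measure of B1a/B2, `W = Φ²/(∏ω)²·[f]²` on the cell
read at `p = (k₁,(k₃,k₂))`) has a SECOND-ORDER MODULUS OF SMOOTHNESS OF ORDER `1 + α` in the dual (test-function) form: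
there are `C` and `α > 0` with `|∫ (2φ(x) − φ(x+δ) − φ(x−δ)) dm_f(x)| ≤ C δ^{1+α}` for every `δ > 0` and every `C²` test
function `φ` with `|φ| ≤ 1` (the constant does NOT see `φ″`: Besov `B^{1+α}_{1,∞}` regularity of `m_f`). Why true / proof
plan: `∫ ψ dm_f = ∫_cell W·(ψ∘Ω) dk` (`levelShift_integral_map_withDensity`); `φ(E+δ) − 2φ(E) + φ(E−δ) =
∫₀^δ∫_{−u}^{u} φ″(E+v) dv du`; on a chart where `|∂_jΩ| ≥ λ` and `χ` is a `C²` cutoff, two integrations by parts in `k_j`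
(`φ″(Ω+v)·W χ = D²[φ(Ω+v)]·Wχ`, `D = (∂_jΩ)⁻¹∂_j`, periodic/compact boundary terms) give `|∫ Wχ·(2φ(Ω) − φ(Ω+δ) − φ(Ω−δ))|
≤ δ²‖(D†)²(Wχ)‖_{L¹}` — `O(δ²)` on every FIXED chart; the critical set of `Ω` on `𝕋³` is explicit (all four group velocities
equal: the co-moving curves and the diagonal INSIDE the exchange planes `{k₃=k₁} ∪ {k₃=k₂}`, all at level `0`
(`MourreDissolution.stub_pairThreshold`), plus the two extrema `(0,0,π)`, `(π,π,0)`), and there `W` vanishes to 2nd order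
(`[f]` vanishes on the exchange planes; at the extrema `[f] = 2(f(0) − f(π)) = 0` for odd `f`, and a Morse extremum costs only
`δ^{3/2}` anyway); discard tubes of radius `η` around it (`|2φ − φ(·+δ) − φ(·−δ)| ≤ 4`, mass `≤ Cη⁴`) and sum the chart bound
over dyadic shells (`|∇Ω| ≳ r`, cutoff scale `r`, `W ≲ r²`: `δ²·r⁻⁴·r²·r²` per shell) — total `O(δ² log(1/δ)) + O(η⁴)`,
`η = δ^{1/2}`: any `α < 1`. Why it might fail: only through an unclassified degenerate point of the co-moving curves (normal
form worse than Morse–Bott), which would lower `α` but not kill it (any algebraic singularity of the DOS has a positive-order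
second modulus). Weaker than v3's B1b (C¹ ∩ W^{1+α,1} density ⇒ this), hence at least as true; the sibling crux's LANDED
fibre/slab/Jacobian-floor technology (`MonotoneFibreDensity`, `RegularValueDensity`, `JacobianFloor`, `PlaneTransversal`,
`SheetTransversal`, `SlabNonconcentration`, `stub_pairThreshold`, `thresholdDensityContinuous`) is the toolbox.
[cite: AokiLukkarinenSpohn2006, §4 (4.3)–(4.8), (4.16)] [cite: Lukkarinen2016, §2.2.4 and §3.4] -/
theorem stub_excursionSecondDifference :
    ∀ ω₂ a b : ℝ, 0 < ω₂ → ∀ f : ℝ → ℝ,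
      (∃ (M : ℕ) (c : Fin M → ℝ), f = fun k => ∑ i, c i * Real.sin (((i : ℕ) + 1 : ℕ) * k)) →
      ∃ C α : ℝ, 0 < α ∧ ∀ δ : ℝ, 0 < δ → ∀ φ : ℝ → ℝ, ContDiff ℝ 2 φ → (∀ x, |φ x| ≤ 1) →
        |∫ x, (2 * φ x - φ (x + δ) - φ (x - δ))
            ∂(MeasureTheory.Measure.map (fun p : ℝ × ℝ × ℝ => resonanceFn ω₂ p.1 p.2.2 p.2.1)
              (((volume.restrict (Set.Ioc (-Real.pi) Real.pi)).prod
                  ((volume.restrict (Set.Ioc (-Real.pi) Real.pi)).prod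
                    (volume.restrict (Set.Ioc (-Real.pi) Real.pi)))).withDensity
                (fun p : ℝ × ℝ × ℝ => ENNReal.ofReal
                  (vertex a b p.1 p.2.2 p.2.1 ^ 2 /
                      (dispersion ω₂ p.1 * dispersion ω₂ p.2.2 * dispersion ω₂ p.2.1 *
                        dispersion ω₂ (p.1 + p.2.2 - p.2.1)) ^ 2 *
                    (f p.1 + f p.2.2 - f p.2.1 - f (p.1 + p.2.2 - p.2.1)) ^ 2))))| ≤
          C * δ ^ (1 + α) :=
  -- skeleton v6 (lead c13): B1b″ from the sup bound C6 alone (p159900 `stub_excursionSecondDifference_of_supBound`)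
  Summit.AtomisticToContinuum.FouriersLaw.Theorems.DrudeDissolution.KineticPolymerGasOnTheTimeAxis.stub_excursionSecondDifference_of_supBound
    stub_supBoundPackage

/-- **Stub B1c″ — `stub_integrableOn_cosTransform_of_secondDifference` (PROVABLE NOW, size S–M; generic real analysis,
Mathlib only).** If a finite measure `m` on `ℝ` has a second-order modulus of order `1 + α` (`α > 0`) in the dual form —
`|∫ (2φ(x) − φ(x+δ) − φ(x−δ)) dm| ≤ C δ^{1+α}` for all `δ > 0` and all `C²` test functions `|φ| ≤ 1` — then its cosine
transform `F(t) = ∫ cos(t x) dm(x)` is integrable on `(0, ∞)`. Proof: `F` is continuous (dominated convergence, `|cos| ≤ 1`,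
`m` finite) with `|F| ≤ m(ℝ)`; for `t > 0` take `φ = cos(t·)` and `δ = π/t`: `cos(t(x ± π/t)) = −cos(tx)`, so
`∫ (2φ − φ(·+δ) − φ(·−δ)) dm = 4F(t)` and `|F(t)| ≤ (C/4)(π/t)^{1+α}`; integrable on `(0,1]` by the sup bound and on `(1,∞)`
by `integrableOn_Ioi_rpow_of_lt` (exponent `−1−α < −1`). [folklore] -/
theorem stub_integrableOn_cosTransform_of_secondDifference :
    ∀ (m : MeasureTheory.Measure ℝ) [MeasureTheory.IsFiniteMeasure m] (C α : ℝ), 0 < α →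
      (∀ δ : ℝ, 0 < δ → ∀ φ : ℝ → ℝ, ContDiff ℝ 2 φ → (∀ x, |φ x| ≤ 1) →
        |∫ x, (2 * φ x - φ (x + δ) - φ (x - δ)) ∂m| ≤ C * δ ^ (1 + α)) →
      MeasureTheory.IntegrableOn (fun t : ℝ => ∫ x, Real.cos (t * x) ∂m) (Set.Ioi 0) :=
  Summit.AtomisticToContinuum.FouriersLaw.Theorems.DrudeDissolution.KineticPolymerGasOnTheTimeAxis.stub_integrableOn_cosTransform_of_secondDifference

/-- **Stub B2 — `stub_excursionIntegralFGR` (PROVABLE NOW, size M; Abel + Fubini + the landed Fermi golden rule at the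
threshold).** For `ω₂ > 0`, couplings `a, b`, a `2π`-periodic `C²` profile `f` and any `F ∈ L¹(0,∞)` which is the cosine
transform of `m_f` (`F(t) = ∫cos(tx)dm_f(x)` for all `t`; `m_f` finite by `MourreDissolution.stub_levelShiftPushforward`):
`∫₀^∞ F = (64π²/9)·q_{ω₂,a,b}(f)`. Proof: `∫₀^∞ F = lim_{ν↓0}∫₀^∞ e^{−νt}F(t)dt` (dominated convergence, `|e^{−νt}F| ≤ |F|`);
`∫₀^∞ e^{−νt}F(t)dt = ∫ (∫₀^∞ e^{−νt}cos(tx)dt) dm_f(x) = ∫ ν/(ν² + x²) dm_f(x)` (Fubini: `|e^{−νt}cos| ≤ e^{−νt}`,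
`m_f` finite; `integral_exp_neg_mul_cos`-type evaluation, cf. the route's landed `AbelOfSpectralDensity` proof
`Theorems/AbelOfSpectralDensity*.lean`); this is `R_f(ν, 0)` by `stub_levelShiftPushforward` (second clause, `E = 0`,
`(x − 0)²`), which tends to `(4π/alsPrefactor)·q(f).toReal` by `fermiGoldenRule_threshold`; uniqueness of limits along
`𝓝[>] 0` and `4π/alsPrefactor = 64π²/9` (`alsPrefactor = 9/(16π)`, `unfold alsPrefactor; field_simp; ring`).
Leans on (all landed): `MourreDissolution.stub_levelShiftPushforward`, `MourreDissolution.fermiGoldenRule_threshold`,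
`PhononBoltzmann.alsPrefactor(_pos)`, `EmbeddedDrudeMourre.AbelOfSpectralDensity` tools. [folklore]
[cite: AokiLukkarinenSpohn2006, eqs. (3.17)-(3.20), (4.10)-(4.11)] -/
theorem stub_excursionIntegralFGR :
    ∀ ω₂ a b : ℝ, 0 < ω₂ → ∀ f : ℝ → ℝ, Function.Periodic f (2 * Real.pi) → ContDiff ℝ 2 f →
      ∀ F : ℝ → ℝ,
        (∀ t : ℝ, F t = ∫ x, Real.cos (t * x) ∂(MeasureTheory.Measure.map (fun p : ℝ × ℝ × ℝ => resonanceFn ω₂ p.1 p.2.2 p.2.1)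
            (((volume.restrict (Set.Ioc (-Real.pi) Real.pi)).prod
                ((volume.restrict (Set.Ioc (-Real.pi) Real.pi)).prod
                  (volume.restrict (Set.Ioc (-Real.pi) Real.pi)))).withDensity
              (fun p : ℝ × ℝ × ℝ => ENNReal.ofReal
                (vertex a b p.1 p.2.2 p.2.1 ^ 2 /
                    (dispersion ω₂ p.1 * dispersion ω₂ p.2.2 * dispersion ω₂ p.2.1 *
                      dispersion ω₂ (p.1 + p.2.2 - p.2.1)) ^ 2 *
                  (f p.1 + f p.2.2 - f p.2.1 - f (p.1 + p.2.2 - p.2.1)) ^ 2))))) →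
        MeasureTheory.IntegrableOn F (Set.Ioi 0) →
        ∫ t in Set.Ioi (0 : ℝ), F t = (64 * π ^ 2 / 9) * (boltzmannForm ω₂ a b f).toReal :=
  Summit.AtomisticToContinuum.FouriersLaw.Theorems.DrudeDissolution.KineticPolymerGasOnTheTimeAxis.stub_excursionIntegralFGR

/-- Odd trigonometric polynomials `Σ cᵢ sin((i+1)k)` are continuous. [folklore] -/
theorem trigPoly_continuous {M : ℕ} (c : Fin M → ℝ) :
    Continuous fun k : ℝ => ∑ i, c i * Real.sin (((i : ℕ) + 1 : ℕ) * k) := by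
  fun_prop

/-- Odd trigonometric polynomials `Σ cᵢ sin((i+1)k)` are `C²` (indeed smooth). [folklore] -/
theorem trigPoly_contDiff {M : ℕ} (c : Fin M → ℝ) :
    ContDiff ℝ 2 fun k : ℝ => ∑ i, c i * Real.sin (((i : ℕ) + 1 : ℕ) * k) := by
  apply ContDiff.sum
  intro i _
  exact contDiff_const.mul (Real.contDiff_sin.comp (contDiff_const.mul contDiff_id))

/-- Odd trigonometric polynomials `Σ cᵢ sin((i+1)k)` are `2π`-periodic. [folklore] -/
theorem trigPoly_periodic {M : ℕ} (c : Fin M → ℝ) :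
    Function.Periodic (fun k : ℝ => ∑ i, c i * Real.sin (((i : ℕ) + 1 : ℕ) * k)) (2 * Real.pi) := by
  intro k
  refine Finset.sum_congr rfl fun i _ => ?_
  rw [mul_add, Real.sin_add_nat_mul_two_pi]

/-- **B, composed (lead c13, v4): B1a ∧ B1b″ ∧ B1c″ ∧ B2 ⇒ `stub_freeOddExcursionKernel`** (statement byte-identical to
the v2 stub consumed by M; kernel-checked glue, no `sorry` of its own; finiteness of `m_f` from the sibling's LANDED
`MourreDissolution.stub_levelShiftPushforward`). -/
theorem stub_freeOddExcursionKernel :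
    ∀ ω₂ a b : ℝ, 0 < ω₂ → ∀ f : ℝ → ℝ,
      (∃ (M : ℕ) (c : Fin M → ℝ), f = fun k => ∑ i, c i * Real.sin (((i : ℕ) + 1 : ℕ) * k)) →
      IntegrableOn (fun t : ℝ => ∫ k in Set.pi Set.univ (fun _ : Fin 3 => Set.Ioc (-π) π),
          vertex a b (k 0) (k 1) (k 2) ^ 2 *
            (f (k 0) + f (k 1) - f (k 2) - f (k 0 + k 1 - k 2)) ^ 2 /
            (dispersion ω₂ (k 0) * dispersion ω₂ (k 1) * dispersion ω₂ (k 2) *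
              dispersion ω₂ (k 0 + k 1 - k 2)) ^ 2 *
            Real.cos (t * resonanceFn ω₂ (k 0) (k 1) (k 2))) (Set.Ioi 0) ∧
      ∫ t in Set.Ioi (0 : ℝ), (∫ k in Set.pi Set.univ (fun _ : Fin 3 => Set.Ioc (-π) π),
          vertex a b (k 0) (k 1) (k 2) ^ 2 *
            (f (k 0) + f (k 1) - f (k 2) - f (k 0 + k 1 - k 2)) ^ 2 /
            (dispersion ω₂ (k 0) * dispersion ω₂ (k 1) * dispersion ω₂ (k 2) *
              dispersion ω₂ (k 0 + k 1 - k 2)) ^ 2 *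
            Real.cos (t * resonanceFn ω₂ (k 0) (k 1) (k 2))) =
        (64 * π ^ 2 / 9) * (boltzmannForm ω₂ a b f).toReal := by
  intro ω₂ a b hω f hf
  obtain ⟨M, c, rfl⟩ := hf
  have hfc := trigPoly_continuous c
  -- finiteness of `m_f` (sibling crux, landed)
  haveI := (Theorems.MourreDissolution.stub_levelShiftPushforward ω₂ a b hω _ hfc).1
  -- B1b″: the second-order modulus of `m_f` in dual form
  obtain ⟨C, α, hα, hmod⟩ := stub_excursionSecondDifference ω₂ a b hω _ ⟨M, c, rfl⟩
  -- B1c″: hence the cosine transform of `m_f` is integrable on `(0, ∞)`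
  have hL1 := stub_integrableOn_cosTransform_of_secondDifference _ C α hα hmod
  -- B1a: the cube kernel IS that cosine transform
  have hcos := stub_excursionKernelPushforward ω₂ a b hω _ hfc
  have hL1' : IntegrableOn (fun t : ℝ => ∫ k in Set.pi Set.univ (fun _ : Fin 3 => Set.Ioc (-π) π),
      vertex a b (k 0) (k 1) (k 2) ^ 2 *
        ((fun k : ℝ => ∑ i, c i * Real.sin (((i : ℕ) + 1 : ℕ) * k)) (k 0) +
            (fun k : ℝ => ∑ i, c i * Real.sin (((i : ℕ) + 1 : ℕ) * k)) (k 1) -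
            (fun k : ℝ => ∑ i, c i * Real.sin (((i : ℕ) + 1 : ℕ) * k)) (k 2) -
            (fun k : ℝ => ∑ i, c i * Real.sin (((i : ℕ) + 1 : ℕ) * k)) (k 0 + k 1 - k 2)) ^ 2 /
        (dispersion ω₂ (k 0) * dispersion ω₂ (k 1) * dispersion ω₂ (k 2) *
          dispersion ω₂ (k 0 + k 1 - k 2)) ^ 2 *
        Real.cos (t * resonanceFn ω₂ (k 0) (k 1) (k 2))) (Set.Ioi 0) := by
    refine hL1.congr_fun (fun t _ => (hcos t).symm) measurableSet_Ioi
  -- B2: Abel + Fubini + Fermi's golden rule at the threshold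
  exact ⟨hL1', stub_excursionIntegralFGR ω₂ a b hω _ (trigPoly_periodic c) (trigPoly_contDiff c) _ hcos hL1'⟩

/-! ## Stub D — the one-step Markov property: odd quadratic charges contract over one kinetic time step -/

/-- **Stub D — ONE-STEP CONTRACTION OF THE ODD QUADRATIC CHARGES (the one-step Markov property, triage r1-1 (d) /
r1-3 (b); where `H` enters; size XL — the finite-window kinetic limit at ONE kinetic time in quadratic-form shape,
shared in substance with `KineticCorner.KineticLimit` stmt-3431 but uniform over the odd one-phonon profiles).**
For `pinnedChain ω₂ lam β γ` (all `> 0`) with `HasOddSectorGap ω₂ lam β` there are `θ ∈ [0,1)` and `T₀ > 0` such that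
for `T ∈ (0,T₀)`, every Buttà–Marchioro-class dynamics `D` (`D.carrier = bmGood`) and every zero-wavenumber datum `Z`
over `D` whose state is DLR at `T` and momentum-reversal symmetric, with coordinates in `Z.localObs` and `Z.localObs`
closed under products: for every ODD QUADRATIC CHARGE DENSITY `a = q_0 · Σ_n c_n (p_{n+1} − p_{−(n+1)})`
(`c : ℕ →₀ ℝ`; these are exactly the densities of the one-phonon charges `∫ g(k) n(k) dk` with odd profile
`g ∝ Σ c_n sin((n+1)k)`: `n_odd(k) = −Im(q̂(k)* p̂(k))`) one has
`|⟪[a], U_{T⁻²} [a]⟫₀| ≤ θ ‖[a]‖₀²` — the numerical range of the exact one-step reduced map `P U_ν P`, `ν = T⁻²` (one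
kinetic time unit), on the odd-charge sector is `≤ θ < 1` UNIFORMLY in `T` and in the profile. Since `⟪x, U_ν y⟫ =
⟪y, U_ν x⟫` for Θ-odd `x, y` (triage r1-3 §E4(a)), `P U_ν P` is symmetric there and this IS `‖P U_ν P‖ ≤ θ` on the
closure — the dissipativity input `(1−g) = θ`, `C = 1` of Stub M(i). Intended proof: kinetic limit of the compressed
one-step map, `⟪[a_c], U_{τT⁻²}[a_{c'}]⟫₀/T² → ⟨f_c, e^{−τ𝓖} f_{c'}⟩_W` with the SYMMETRIC generator `𝓖 ≥ 0` whose form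
is `(64π²/9)⁻¹`-proportional to ALS's `q = boltzmannForm ω₂ lam β` in the `W`-weighted normalisation (Stub B's FGR
identity; no `+iΛ`: the odd sector is real symmetric), uniformly on the unit ball of profiles (smoothing comes from the
thermal weight and the bracket; triage r1-2 (i) is the risk), and `H` ⇒ `⟨f, e^{−𝓖} f⟩ ≤ e^{−g₀'}‖f‖²` on odd `f`
(spectral theorem). The margin is the ON-SITE floor `g₀ ∝ lam²` (β-transparency, kit j013984/j013995, sibling
`hasOddSectorGap_onSite_of`): `θ = θ(ω₂, lam, β)` only. MD-testable per profile (the card's `F(τ = 1) < 1`).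
[cite: AokiLukkarinenSpohn2006, §3 (3.19)–(3.23); LukkarinenSpohn2011 (arXiv:0901.3283) Thm 2.4 (the only lattice
kinetic limit in print: DNLS, d ≥ 4); Lukkarinen2016 §3.3–3.4; DeRoeckKupiainen2011 arXiv:1005.1080 §1.7.1, §3] -/
theorem stub_oneStepContraction :
    ∀ ω₂ lam β γ : ℝ, 0 < ω₂ → 0 < lam → 0 < β → 0 < γ → HasOddSectorGap ω₂ lam β →
      ∃ θ T₀ : ℝ, 0 ≤ θ ∧ θ < 1 ∧ 0 < T₀ ∧ ∀ T : ℝ, 0 < T → T < T₀ →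
        ∀ (D : InfiniteChainDynamics (pinnedChain ω₂ lam β γ))
          (Z : ZeroWavenumberData (pinnedChain ω₂ lam β γ) D),
          D.carrier = (pinnedChain ω₂ lam β γ).bmGood →
          (pinnedChain ω₂ lam β γ).IsChainGibbsMeasure T Z.μ → Z.HasMomentumReversal →
          (∀ x : ℤ, (fun σ : ChainConfig => (σ x).1) ∈ Z.localObs) →
          (∀ x : ℤ, (fun σ : ChainConfig => (σ x).2) ∈ Z.localObs) →
          (∀ a ∈ Z.localObs, ∀ b ∈ Z.localObs, a * b ∈ Z.localObs) →
          ∀ a : ChainConfig → ℝ,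
            (∃ c : ℕ →₀ ℝ, a = fun σ : ChainConfig =>
              (σ 0).1 * c.sum (fun n r => r * ((σ ((n : ℤ) + 1)).2 - (σ (-((n : ℤ) + 1))).2))) →
            |⟪Z.fluct a, Z.koopman (1 / T ^ 2) (Z.fluct a)⟫_ℝ| ≤
              θ * ‖Z.fluct a‖ ^ 2 := by
  sorry

/-! ## Stub F — the RICH zero-wavenumber framework over the Buttà–Marchioro dynamics -/

/-- **Stub F — the rich zero-wavenumber framework** (infrastructure, size L; independent of `H` and of the bet; a
SUPERSET of the conjuncts of the sibling skeletons' `stub_framework` / `stub_zeroWavenumberFramework` of crux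
stmt-12594 — one proof serves all three lines — plus the carrier/covariance clauses of the LANDED `canonicalDatum`).
For `pinnedChain ω₂ lam β γ` (all `> 0`) there is `T₀ > 0` such that for `T ∈ (0, T₀)` there are an infinite-volume
dynamics `D` with `D.carrier = bmGood` whose flow commutes with the lattice translations everywhere, and Doyon data
`Z : ZeroWavenumberData (pinnedChain …) D` whose state is a DLR Gibbs state at `T`, momentum-reversal symmetric, with
strongly continuous Koopman group, spatial-reflection symmetric (`ι : (σ_x) ↦ (σ_{−x})` preserves `Z.μ`, the carrier and
`𝒱`), and whose observable space `𝒱 = Z.localObs` contains all coordinates `q_x, p_x` and is closed under products —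
so every local polynomial, in particular every odd quadratic charge density of Stub D and the quartic force
`{Q_f, H₄}`, has a class in `ℋ₀(μ_T)`. The LANDED `Theorems.MourreDissolution.canonicalDatum` gives all of this except
richness (its `𝒱` is the span of the space-time translates of `j_0, h_0`): extend `stub_gibbsClustering`'s summable
space-time clustering and continuity from `{j, h}` to local polynomials (finite-speed / light-cone estimates
`InfiniteChainLightCone` + exponential mixing of the 1-D massive log-concave DLR state, `ChainMixingClustering`) and run
`exists_zeroWavenumberData_of_clustering` on the polynomial algebra. [cite: Doyon2022, §4.1 Def. 4.3–4.4, Thm 4.11;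
ButtaMarchioro2016 Thm 2.1; LanfordLebowitzLieb1977 Thm 2–3] -/
theorem stub_richFramework :
    ∀ ω₂ lam β γ : ℝ, 0 < ω₂ → 0 < lam → 0 < β → 0 < γ →
      ∃ T₀ : ℝ, 0 < T₀ ∧ ∀ T : ℝ, 0 < T → T < T₀ →
        ∃ (D : InfiniteChainDynamics (pinnedChain ω₂ lam β γ))
          (Z : ZeroWavenumberData (pinnedChain ω₂ lam β γ) D),
          D.carrier = (pinnedChain ω₂ lam β γ).bmGood ∧
          (∀ (t : ℝ) (x : ℤ), D.flow t ∘ chainShift x = chainShift x ∘ D.flow t) ∧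
          (pinnedChain ω₂ lam β γ).IsChainGibbsMeasure T Z.μ ∧ Z.HasMomentumReversal ∧
          Z.toFluctuationDynamics.IsStronglyContinuous ∧
          MeasurePreserving (fun (σ : ChainConfig) (i : ℤ) => σ (-i)) Z.μ Z.μ ∧
          Set.MapsTo (fun (σ : ChainConfig) (i : ℤ) => σ (-i)) D.carrier D.carrier ∧
          (∀ a ∈ Z.localObs, (a ∘ fun (σ : ChainConfig) (i : ℤ) => σ (-i)) ∈ Z.localObs) ∧
          (∀ x : ℤ, (fun σ : ChainConfig => (σ x).1) ∈ Z.localObs) ∧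
          (∀ x : ℤ, (fun σ : ChainConfig => (σ x).2) ∈ Z.localObs) ∧
          (∀ a ∈ Z.localObs, ∀ b ∈ Z.localObs, a * b ∈ Z.localObs) :=
  Summit.AtomisticToContinuum.FouriersLaw.Theorems.DrudeDissolution.KineticPolymerGasOnTheTimeAxis.stub_richFramework

/-! ## Stub M — THE BET: the odd sector of the chain is a dilute dissipative polymer gas on the kinetic lattice -/

/-- **Stub M — THE BET (load-bearing, hardest; size XL / open — De Roeck–Kupiainen's "far dream" §1.6.2 for an
interacting reservoir, placed where both their walls are thinnest): the odd charge sector of the low-temperature pinned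
chain is a DILUTE DISSIPATIVE POLYMER GAS ON THE KINETIC TIME LATTICE.** Hypotheses, BY NAME: `H = HasOddSectorGap
ω₂ lam β` (LANDED `FGRGap_proof`), the conclusion of Stub B at the chain's vertex `(a,b) = (lam, β)` (free excursion
kernel `∈ L¹(dt)` + FGR identity), the conclusion of Stub D (one-step contraction). Conclusion: there are
`T`-INDEPENDENT constants `C ≥ 1`, `g ∈ (0,1)`, `p₀ > 0` such that for every smallness `δ > 0` there is `T₀ > 0` with:
for every `T ∈ (0,T₀)` and every rich datum `(D, Z)` as delivered by Stub F there are a CLOSED subspace `K ∋ [J]` of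
`ℋ₀(μ_T)` (intended: closure of `{[q_0 Σ c_n(p_n − p_{−n})]} ∪ {[J]}` inside the reflection-odd sector `ℋ₀^{ι−}`;
`P = K.starProjection`), leg operators `act s N A ι τ ∈ B(ℋ₀)` and a number `Ptot` such that, with `ν = T⁻²`,
`U_t = Z.koopman t`:
(i) DISSIPATIVITY of the exact one-step reduced map: `‖(P U_ν P)ⁿ‖ ≤ C(1−g)ⁿ` (from Stub D on the odd charges, the
dispersive decay of the `[J]`-excess direction, and symmetry of `P U_ν P`);
(ii) POLYMER REPRESENTATION WITH δ-SMALL ACTIVITIES (DK §2.1–2.2, (2.12), Ass. 2.2), uniformly in the partial last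
step `s ∈ [0, ν)`: `P U_{Nν+s} P − (P U_s P)(P U_ν P)ᴺ = Σ_{𝒞} 𝒯[⋯]` exactly in the shape Stub A consumes, with
`Σ_{(A,ι): max A = τ₀} (C/(1−g))^{|A|} Π_τ ‖act s N A ι τ‖ ≤ δ` — the legs are the elementary-tensor pieces of the
CONNECTED EXCURSION operators `𝔼ᶜ(B(A))` built from the Duhamel expansion in the quartic vertex on each kinetic slot,
Wick pairings with the thermal covariance plus the static cumulants of `μ_T` (Lukkarinen–Marcozzi–Nota cumulant
hierarchy), ladders resummed into the monomer; `|A| ≥ 2` because `P B P = 0`; smallness `δ(T) → 0` because a line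
connecting two slots of length `ν = T⁻²` costs `λ²∫∫|k(s−s')| = O(T) + o(1)` by Stub B (DK §3's derivation of
Ass. 2.2 from Ass. 1.2), the Kotecký–Preiss weight `(C/(1−g))^{|A|}` being affordable because `g` is the on-site floor
of Stub D, fixed before `δ`; DECLARED SPECIES (triage (b)/(c)): the `(j,n)` current×number pair channel (Θ-odd,
`t^{−3/2}` kernel cut off at the number lifetime `∝ T^{−4}`) and the `[J]`-excess (cubic part of the current,
`O(βT)`) must be carried as explicit polymer species with their own activity bounds — the first place a non-decaying
activity can hide;
(iii) the MARKOV PLATEAU: `Σ_N ∫₀^ν ⟪[J], (P U_s P)(P U_ν P)ᴺ [J]⟫ ds = Ptot ≥ p₀` (`Ptot ≈ ⟪[J], 𝓖_T⁻¹[J]⟫ ≈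
T²κ_kin·(2π…) = (2π)⁻¹·inverseForm ω₂ lam β (currentVector ω₂)·(1 + o(1))`, T-INDEPENDENT — the MD plateau
`πg_T(0) ≈ 7 ± 2` of KitResults-ideator2; positivity alone needs only Cauchy–Schwarz `⟨w,𝓖⁻¹w⟩ ≥ ‖w‖⁴/⟨w,𝓖w⟩` and
`q(ω'ω⁻²-profile) < ∞`, `KineticConductivityFinite`).
NOT a costume: with `K = span[J]` (1-dim) the representation forces the scalar `C_T(Nν+s)/C_T(0)` to be a
`δ`-perturbed Markov chain, which the MD profile (fast drop + `7/τ` segment) is not — (ii) pins `K` to a genuinely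
Markovian (kinetic) sector; with `K` `U`-invariant, (i) fails (`‖Tⁿ‖ = 1`); activities `≡ 0` force exact Markovianity,
again excluded by (i). The lead may `--split` M into M(i) [= Stub D + excess direction], M(ii) [the gas], M(iii)
[kinetic identification of the plateau] once F lands. [cite: DeRoeckKupiainen2011, arXiv:1005.1080 §1.6.1–1.6.2,
§1.7, §2.1–2.5 (2.12), §3; DeRoeckKupiainen2013 doi:10.1007/s00220-013-1794-y; KoteckyPreiss1986
doi:10.1007/bf01211762; LukkarinenMarcozziNota2018 doi:10.1007/s10955-018-2000-6; LukkarinenMarcozzi2016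
doi:10.1063/1.4960556; BricmontKupiainen1996 doi:10.1007/bf02108821; AokiLukkarinenSpohn2006 §3–4] -/
theorem stub_oddSectorMarkovGas :
    ∀ ω₂ lam β γ : ℝ, 0 < ω₂ → 0 < lam → 0 < β → 0 < γ → HasOddSectorGap ω₂ lam β →
      -- (B) the free odd excursion kernel of the (2,2) sector at the chain's vertex
      (∀ f : ℝ → ℝ,
        (∃ (M : ℕ) (c : Fin M → ℝ), f = fun k => ∑ i, c i * Real.sin (((i : ℕ) + 1 : ℕ) * k)) →
        IntegrableOn (fun t : ℝ => ∫ k in Set.pi Set.univ (fun _ : Fin 3 => Set.Ioc (-π) π),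
            vertex lam β (k 0) (k 1) (k 2) ^ 2 *
              (f (k 0) + f (k 1) - f (k 2) - f (k 0 + k 1 - k 2)) ^ 2 /
              (dispersion ω₂ (k 0) * dispersion ω₂ (k 1) * dispersion ω₂ (k 2) *
                dispersion ω₂ (k 0 + k 1 - k 2)) ^ 2 *
              Real.cos (t * resonanceFn ω₂ (k 0) (k 1) (k 2))) (Set.Ioi 0) ∧
        ∫ t in Set.Ioi (0 : ℝ), (∫ k in Set.pi Set.univ (fun _ : Fin 3 => Set.Ioc (-π) π),
            vertex lam β (k 0) (k 1) (k 2) ^ 2 *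
              (f (k 0) + f (k 1) - f (k 2) - f (k 0 + k 1 - k 2)) ^ 2 /
              (dispersion ω₂ (k 0) * dispersion ω₂ (k 1) * dispersion ω₂ (k 2) *
                dispersion ω₂ (k 0 + k 1 - k 2)) ^ 2 *
              Real.cos (t * resonanceFn ω₂ (k 0) (k 1) (k 2))) =
          (64 * π ^ 2 / 9) * (boltzmannForm ω₂ lam β f).toReal) →
      -- (D) the one-step contraction of the odd quadratic charges
      (∃ θ T₀ : ℝ, 0 ≤ θ ∧ θ < 1 ∧ 0 < T₀ ∧ ∀ T : ℝ, 0 < T → T < T₀ →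
        ∀ (D : InfiniteChainDynamics (pinnedChain ω₂ lam β γ))
          (Z : ZeroWavenumberData (pinnedChain ω₂ lam β γ) D),
          D.carrier = (pinnedChain ω₂ lam β γ).bmGood →
          (pinnedChain ω₂ lam β γ).IsChainGibbsMeasure T Z.μ → Z.HasMomentumReversal →
          (∀ x : ℤ, (fun σ : ChainConfig => (σ x).1) ∈ Z.localObs) →
          (∀ x : ℤ, (fun σ : ChainConfig => (σ x).2) ∈ Z.localObs) →
          (∀ a ∈ Z.localObs, ∀ b ∈ Z.localObs, a * b ∈ Z.localObs) →
          ∀ a : ChainConfig → ℝ,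
            (∃ c : ℕ →₀ ℝ, a = fun σ : ChainConfig =>
              (σ 0).1 * c.sum (fun n r => r * ((σ ((n : ℤ) + 1)).2 - (σ (-((n : ℤ) + 1))).2))) →
            |⟪Z.fluct a, Z.koopman (1 / T ^ 2) (Z.fluct a)⟫_ℝ| ≤
              θ * ‖Z.fluct a‖ ^ 2) →
      ∃ C g p₀ : ℝ, 1 ≤ C ∧ 0 < g ∧ g < 1 ∧ 0 < p₀ ∧ ∀ δ : ℝ, 0 < δ →
        ∃ T₀ : ℝ, 0 < T₀ ∧ ∀ T : ℝ, 0 < T → T < T₀ →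
        ∀ (D : InfiniteChainDynamics (pinnedChain ω₂ lam β γ))
          (Z : ZeroWavenumberData (pinnedChain ω₂ lam β γ) D),
          D.carrier = (pinnedChain ω₂ lam β γ).bmGood →
          (∀ (t : ℝ) (x : ℤ), D.flow t ∘ chainShift x = chainShift x ∘ D.flow t) →
          (pinnedChain ω₂ lam β γ).IsChainGibbsMeasure T Z.μ → Z.HasMomentumReversal →
          Z.toFluctuationDynamics.IsStronglyContinuous →
          MeasurePreserving (fun (σ : ChainConfig) (i : ℤ) => σ (-i)) Z.μ Z.μ →
          Set.MapsTo (fun (σ : ChainConfig) (i : ℤ) => σ (-i)) D.carrier D.carrier →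
          (∀ a ∈ Z.localObs, (a ∘ fun (σ : ChainConfig) (i : ℤ) => σ (-i)) ∈ Z.localObs) →
          (∀ x : ℤ, (fun σ : ChainConfig => (σ x).1) ∈ Z.localObs) →
          (∀ x : ℤ, (fun σ : ChainConfig => (σ x).2) ∈ Z.localObs) →
          (∀ a ∈ Z.localObs, ∀ b ∈ Z.localObs, a * b ∈ Z.localObs) →
          ∃ (K : Submodule ℝ (ZeroWavenumberSpace Z))
            (hK : IsClosed (K : Set (ZeroWavenumberSpace Z))),
            haveI : CompleteSpace K := hK.completeSpace_coe
            Z.currentClass ∈ K ∧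
            ∃ (act : ℝ → ℕ → Finset ℕ → ℕ → ℕ → (ZeroWavenumberSpace Z →L[ℝ] ZeroWavenumberSpace Z))
              (Ptot : ℝ),
              -- (i) dissipativity of the exact one-step reduced map on K (step = the kinetic time T⁻²)
              (∀ n : ℕ, ‖(K.starProjection * (Z.koopman (1 / T ^ 2) : ZeroWavenumberSpace Z →L[ℝ] ZeroWavenumberSpace Z) *
                  K.starProjection) ^ n‖ ≤ C * (1 - g) ^ n) ∧
              -- (ii) the polymer representation of the reduced evolution with δ-small weighted activities
              (∀ s ∈ Set.Ico (0 : ℝ) (1 / T ^ 2),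
                (∀ N τ₀ : ℕ,
                  (∑' p : {p : Finset ℕ × ℕ // p.1 ⊆ Finset.Icc 1 (N + 1) ∧ 2 ≤ p.1.card ∧ p.1.max = ↑τ₀},
                    ENNReal.ofReal ((C / (1 - g)) ^ p.1.1.card *
                      ∏ τ ∈ p.1.1, ‖act s N p.1.1 p.1.2 τ‖)) ≤ ENNReal.ofReal δ) ∧
                (∀ N : ℕ, HasSum
                  (fun 𝒞 : {𝒞 : Finset (Finset ℕ × ℕ) // 𝒞.Nonempty ∧
                      (∀ p ∈ 𝒞, p.1 ⊆ Finset.Icc 1 (N + 1) ∧ 2 ≤ p.1.card) ∧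
                      (𝒞 : Set (Finset ℕ × ℕ)).PairwiseDisjoint Prod.fst} =>
                    ((List.range (N + 1)).map (fun i : ℕ =>
                      if (𝒞.1.filter (fun p => N + 1 - i ∈ p.1)) = ∅ then
                        (if i = 0 then
                          K.starProjection * (Z.koopman s : ZeroWavenumberSpace Z →L[ℝ] ZeroWavenumberSpace Z) * K.starProjection
                         else
                          K.starProjection * (Z.koopman (1 / T ^ 2) : ZeroWavenumberSpace Z →L[ℝ] ZeroWavenumberSpace Z) *
                            K.starProjection)
                      else ∑ p ∈ 𝒞.1.filter (fun p => N + 1 - i ∈ p.1),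
                        act s N p.1 p.2 (N + 1 - i))).prod)
                  (K.starProjection * (Z.koopman (N * (1 / T ^ 2) + s) : ZeroWavenumberSpace Z →L[ℝ] ZeroWavenumberSpace Z) *
                      K.starProjection -
                    K.starProjection * (Z.koopman s : ZeroWavenumberSpace Z →L[ℝ] ZeroWavenumberSpace Z) * K.starProjection *
                      (K.starProjection * (Z.koopman (1 / T ^ 2) : ZeroWavenumberSpace Z →L[ℝ] ZeroWavenumberSpace Z) *
                        K.starProjection) ^ N))) ∧
              -- (iii) the Markov plateau (T-uniform lower bound of the leading Green–Kubo integral)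
              HasSum (fun N : ℕ => ∫ s in (0 : ℝ)..(1 / T ^ 2),
                  ⟪Z.currentClass,
                    (K.starProjection * (Z.koopman s : ZeroWavenumberSpace Z →L[ℝ] ZeroWavenumberSpace Z) * K.starProjection *
                      (K.starProjection * (Z.koopman (1 / T ^ 2) : ZeroWavenumberSpace Z →L[ℝ] ZeroWavenumberSpace Z) *
                        K.starProjection) ^ N) Z.currentClass⟫_ℝ) Ptot ∧
              p₀ ≤ Ptot := by
  sorry

/-! ## Composition — kernel-checked: the six stubs, used BY NAME, imply the crux BY NAME (no `sorry` here) -/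

/-- **Composition.** `H := FGRGap_proof` (landed); `(C, g, p₀) :=` Stub M fed with `H`, Stub B, Stub D; `B :=`
`currentVariance_le` (landed, `C_T(0) ≤ B T²`); `δ := min (g/4) (p₀g²/(16B⁺C))`; thresholds from M, F,
`currentVariance_le`; at `T < T₀`: `(D, Z)` from Stub F, `(K, act, Ptot)` from M; `C_T(t) = ⟪[J], (P U_t P)[J]⟫₀`
(`inner_currentClass_koopman_eq_currentCorrelation'`, `P[J] = [J]`, `P` self-adjoint); Stub A for every partial step
`s ∈ [0, ν)` gives `Σ_N |C_T(Nν+s) − m N s| ≤ ‖[J]‖²·8Cδ/g²`; the main terms are a geometric series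
`≤ ‖[J]‖² C(1−g)ᴺ`; Stub E gives `C_T ∈ L¹(0,∞)` and `|∫₀^∞ C_T − Ptot| ≤ ν‖[J]‖²8Cδ/g² ≤ B⁺·8Cδ/g² ≤ p₀/2`, hence
`∫₀^∞ C_T ≥ p₀/2 > 0`; `C_T` is continuous, even, of positive type (`regular_of_zeroWavenumberData`), so the landed
`stub_cosineBochner` and `stub_integrableSpectralCriterion` give the finite spectral measure with a continuous window
density, positive at `0`. -/
theorem DrudeDissolution_of :
    Summit.AtomisticToContinuum.FouriersLaw.Theses.EmbeddedDrudeMourre.DrudeDissolution := by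
  intro ω₂ lam β γ hω hl hβ hγ
  -- H (the odd-sector gap, LANDED `FGRGap_proof`) feeds the bet together with Stubs B and D
  have hgap : HasOddSectorGap ω₂ lam β :=
    Summit.AtomisticToContinuum.FouriersLaw.Theorems.FGRGap_proof ω₂ lam β hω hl hβ
  obtain ⟨C, g, p₀, hC1, hg0, hg1, hp₀, hM⟩ :=
    stub_oddSectorMarkovGas ω₂ lam β γ hω hl hβ hγ hgap
      (stub_freeOddExcursionKernel ω₂ lam β hω)
      (stub_oneStepContraction ω₂ lam β γ hω hl hβ hγ hgap)
  have hCpos : 0 < C := lt_of_lt_of_le one_pos hC1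
  -- the a-priori static current variance bound `C_T(0) ≤ B T²` (landed)
  obtain ⟨B, T₁, hT₁, hB⟩ := Theorems.KineticCorner.currentVariance_le ω₂ lam β γ hω hl hβ hγ
  obtain ⟨Bp, hBp, hBBp⟩ : ∃ Bp : ℝ, 0 < Bp ∧ B ≤ Bp :=
    ⟨max B 1, lt_max_of_lt_right one_pos, le_max_left _ _⟩
  -- the smallness parameter of the polymer gas
  obtain ⟨δ, hδpos, hδg, hδp⟩ : ∃ δ : ℝ, 0 < δ ∧ δ ≤ g / 4 ∧ δ ≤ p₀ * g ^ 2 / (16 * Bp * C) :=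
    ⟨min (g / 4) (p₀ * g ^ 2 / (16 * Bp * C)), lt_min (by positivity) (by positivity),
      min_le_left _ _, min_le_right _ _⟩
  obtain ⟨T₂, hT₂, hM'⟩ := hM δ hδpos
  obtain ⟨T₃, hT₃, hF⟩ := stub_richFramework ω₂ lam β γ hω hl hβ hγ
  refine ⟨min T₁ (min T₂ T₃), lt_min hT₁ (lt_min hT₂ hT₃), fun T hT hTlt => ?_⟩
  have h1 : T < T₁ := lt_of_lt_of_le hTlt (min_le_left _ _)
  have h2 : T < T₂ := lt_of_lt_of_le hTlt ((min_le_right _ _).trans (min_le_left _ _))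
  have h3 : T < T₃ := lt_of_lt_of_le hTlt ((min_le_right _ _).trans (min_le_right _ _))
  -- (F): the rich zero-wavenumber datum over the Buttà–Marchioro dynamics at temperature `T`
  obtain ⟨D, Z, hcar, hsh, hG, hrev, hsc, hιμ, hιc, hιo, hq, hp, hmul⟩ := hF T hT h3
  have hsc' : ∀ ψ : ZeroWavenumberSpace Z, Continuous fun t : ℝ => Z.koopman t ψ := fun ψ => hsc ψ
  -- (M): the odd sector is a dilute dissipative polymer gas on the kinetic lattice
  obtain ⟨K, hK, hKrest⟩ := hM' T hT h2 D Z hcar hsh hG hrev hsc hιμ hιc hιo hq hp hmul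
  haveI : CompleteSpace K := hK.completeSpace_coe
  obtain ⟨hJK, act, Ptot, hdiss, hgas, hplat, hp₀P⟩ := hKrest
  -- regularity of `C_T` and the good-triple bundle of the datum (tree lemmas)
  obtain ⟨hP, hA, hcont, heven, hpsd⟩ :=
    Theorems.DrudeDissolution.LineSketch.regular_of_zeroWavenumberData Z hG hsc'
  have hgood := Theorems.MourreDissolution.goodTriple_of_canonicalDatum hsh Z hG hsc'
  have hT2pos : 0 < T ^ 2 := by positivity
  have hνpos : 0 < 1 / T ^ 2 := by positivity
  -- `P [J] = [J]` and `⟪[J], P y⟫ = ⟪[J], y⟫`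
  have hPJ : K.starProjection Z.currentClass = Z.currentClass :=
    Submodule.starProjection_eq_self_iff.mpr hJK
  have hJP : ∀ y : ZeroWavenumberSpace Z, ⟪Z.currentClass, K.starProjection y⟫_ℝ = ⟪Z.currentClass, y⟫_ℝ := by
    intro y
    rw [← Submodule.inner_starProjection_left_eq_right, hPJ]
  -- `C_T(t) = ⟪[J], (P U_t P) [J]⟫`
  have hCf : ∀ t : ℝ, D.currentCorrelation Z.μ t =
      ⟪Z.currentClass, (K.starProjection * (Z.koopman t : ZeroWavenumberSpace Z →L[ℝ] ZeroWavenumberSpace Z) *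
        K.starProjection) Z.currentClass⟫_ℝ := by
    intro t
    show D.currentCorrelation Z.μ t =
      ⟪Z.currentClass, K.starProjection ((Z.koopman t) (K.starProjection Z.currentClass))⟫_ℝ
    rw [hPJ, hJP]
    exact (Z.inner_currentClass_koopman_eq_currentCorrelation' hrev t).symm
  -- `‖[J]‖² = C_T(0) ≤ Bp T²`
  have hJ2 : ‖Z.currentClass‖ ^ 2 ≤ Bp * T ^ 2 := by
    have e0 := Z.inner_currentClass_koopman_eq_currentCorrelation' hrev 0
    have hk0 : Z.koopman 0 Z.currentClass = Z.currentClass :=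
      FluctuationDynamics.koopman_zero_apply Z.toFluctuationDynamics Z.currentClass
    rw [hk0, real_inner_self_eq_norm_sq] at e0
    rw [e0]
    exact (hB T Z.μ D hT h1 hG hgood.2.2.2.2.1 hP).trans (mul_le_mul_of_nonneg_right hBBp hT2pos.le)
  -- norms: `‖U_t‖ ≤ 1`, `‖P U_s P‖ ≤ 1`
  have hUle : ∀ t : ℝ, ‖(Z.koopman t : ZeroWavenumberSpace Z →L[ℝ] ZeroWavenumberSpace Z)‖ ≤ 1 := by
    intro t
    refine ContinuousLinearMap.opNorm_le_bound _ zero_le_one fun x => ?_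
    rw [one_mul]
    exact le_of_eq ((Z.koopman t).norm_map x)
  have hPle : ‖(K.starProjection : ZeroWavenumberSpace Z →L[ℝ] ZeroWavenumberSpace Z)‖ ≤ 1 :=
    Submodule.starProjection_norm_le K
  have hXle : ∀ s : ℝ, ‖K.starProjection * (Z.koopman s : ZeroWavenumberSpace Z →L[ℝ] ZeroWavenumberSpace Z) * K.starProjection‖ ≤ 1 := by
    intro s
    calc ‖K.starProjection * (Z.koopman s : ZeroWavenumberSpace Z →L[ℝ] ZeroWavenumberSpace Z) * K.starProjection‖
        ≤ ‖K.starProjection * (Z.koopman s : ZeroWavenumberSpace Z →L[ℝ] ZeroWavenumberSpace Z)‖ * ‖K.starProjection‖ := norm_mul_le _ _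
      _ ≤ (‖(K.starProjection : ZeroWavenumberSpace Z →L[ℝ] ZeroWavenumberSpace Z)‖ * ‖(Z.koopman s : ZeroWavenumberSpace Z →L[ℝ] ZeroWavenumberSpace Z)‖) *
            ‖(K.starProjection : ZeroWavenumberSpace Z →L[ℝ] ZeroWavenumberSpace Z)‖ :=
          mul_le_mul_of_nonneg_right (norm_mul_le _ _) (norm_nonneg _)
      _ ≤ (1 * 1) * 1 :=
          mul_le_mul (mul_le_mul hPle (hUle s)
            (norm_nonneg ((Z.koopman s : ZeroWavenumberSpace Z →L[ℝ] ZeroWavenumberSpace Z))) zero_le_one) hPle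
            (norm_nonneg (K.starProjection : ZeroWavenumberSpace Z →L[ℝ] ZeroWavenumberSpace Z)) (by norm_num)
      _ = 1 := by norm_num
  -- a matrix element is bounded by the operator norm
  have hme : ∀ A : ZeroWavenumberSpace Z →L[ℝ] ZeroWavenumberSpace Z,
      |⟪Z.currentClass, A Z.currentClass⟫_ℝ| ≤ ‖Z.currentClass‖ ^ 2 * ‖A‖ := by
    intro A
    calc |⟪Z.currentClass, A Z.currentClass⟫_ℝ| ≤ ‖Z.currentClass‖ * ‖A Z.currentClass‖ :=
          abs_real_inner_le_norm _ _
      _ ≤ ‖Z.currentClass‖ * (‖A‖ * ‖Z.currentClass‖) :=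
          mul_le_mul_of_nonneg_left (A.le_opNorm _) (norm_nonneg _)
      _ = ‖Z.currentClass‖ ^ 2 * ‖A‖ := by ring
  -- (A) per partial step `s`: the polymer series is summable with sum `≤ 8Cδ/g²`
  have hsumA : ∀ s ∈ Set.Ico (0 : ℝ) (1 / T ^ 2),
      Summable (fun N : ℕ => ‖K.starProjection * (Z.koopman (N * (1 / T ^ 2) + s) : ZeroWavenumberSpace Z →L[ℝ] ZeroWavenumberSpace Z) *
          K.starProjection -
        K.starProjection * (Z.koopman s : ZeroWavenumberSpace Z →L[ℝ] ZeroWavenumberSpace Z) * K.starProjection *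
          (K.starProjection * (Z.koopman (1 / T ^ 2) : ZeroWavenumberSpace Z →L[ℝ] ZeroWavenumberSpace Z) *
            K.starProjection) ^ N‖) ∧
      ∑' N : ℕ, ‖K.starProjection * (Z.koopman (N * (1 / T ^ 2) + s) : ZeroWavenumberSpace Z →L[ℝ] ZeroWavenumberSpace Z) *
          K.starProjection -
        K.starProjection * (Z.koopman s : ZeroWavenumberSpace Z →L[ℝ] ZeroWavenumberSpace Z) * K.starProjection *
          (K.starProjection * (Z.koopman (1 / T ^ 2) : ZeroWavenumberSpace Z →L[ℝ] ZeroWavenumberSpace Z) *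
            K.starProjection) ^ N‖ ≤ 8 * C * δ / g ^ 2 := by
    intro s hs
    obtain ⟨hact, hrep⟩ := hgas s hs
    exact stub_dilutePolymerGasSum (ZeroWavenumberSpace Z →L[ℝ] ZeroWavenumberSpace Z)
      (K.starProjection * (Z.koopman (1 / T ^ 2) : ZeroWavenumberSpace Z →L[ℝ] ZeroWavenumberSpace Z) *
            K.starProjection)
      (K.starProjection * (Z.koopman s : ZeroWavenumberSpace Z →L[ℝ] ZeroWavenumberSpace Z) * K.starProjection)
      (fun N : ℕ => K.starProjection * (Z.koopman (N * (1 / T ^ 2) + s) : ZeroWavenumberSpace Z →L[ℝ] ZeroWavenumberSpace Z) *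
          K.starProjection)
      (act s) C g δ hC1 hg0 hg1 hδpos.le hδg hdiss (hXle s) hact hrep
  -- (E₁) continuity of the main terms in the partial step (strong continuity of the Koopman group)
  have hmcont : ∀ N : ℕ, Continuous fun s : ℝ => ⟪Z.currentClass,
        (K.starProjection * (Z.koopman s : ZeroWavenumberSpace Z →L[ℝ] ZeroWavenumberSpace Z) * K.starProjection *
          (K.starProjection * (Z.koopman (1 / T ^ 2) : ZeroWavenumberSpace Z →L[ℝ] ZeroWavenumberSpace Z) *
            K.starProjection) ^ N) Z.currentClass⟫_ℝ := by
    intro N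
    have h1 : Continuous fun s : ℝ => ⟪Z.currentClass,
        K.starProjection ((Z.koopman s) (K.starProjection (((K.starProjection * (Z.koopman (1 / T ^ 2) : ZeroWavenumberSpace Z →L[ℝ] ZeroWavenumberSpace Z) *
            K.starProjection) ^ N) Z.currentClass)))⟫_ℝ :=
      continuous_const.inner ((K.starProjection : ZeroWavenumberSpace Z →L[ℝ] ZeroWavenumberSpace Z).continuous.comp
        (hsc' (K.starProjection (((K.starProjection * (Z.koopman (1 / T ^ 2) : ZeroWavenumberSpace Z →L[ℝ] ZeroWavenumberSpace Z) *
            K.starProjection) ^ N) Z.currentClass))))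
    exact h1
  -- (E₂) the error terms: matrix elements of `Z_N - X T^N`, summed by Stub A
  have herr : ∀ s ∈ Set.Ico (0 : ℝ) (1 / T ^ 2),
      Summable (fun N : ℕ => |D.currentCorrelation Z.μ (N * (1 / T ^ 2) + s) - ⟪Z.currentClass,
        (K.starProjection * (Z.koopman s : ZeroWavenumberSpace Z →L[ℝ] ZeroWavenumberSpace Z) * K.starProjection *
          (K.starProjection * (Z.koopman (1 / T ^ 2) : ZeroWavenumberSpace Z →L[ℝ] ZeroWavenumberSpace Z) *
            K.starProjection) ^ N) Z.currentClass⟫_ℝ|) ∧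
      ∑' N : ℕ, |D.currentCorrelation Z.μ (N * (1 / T ^ 2) + s) - ⟪Z.currentClass,
        (K.starProjection * (Z.koopman s : ZeroWavenumberSpace Z →L[ℝ] ZeroWavenumberSpace Z) * K.starProjection *
          (K.starProjection * (Z.koopman (1 / T ^ 2) : ZeroWavenumberSpace Z →L[ℝ] ZeroWavenumberSpace Z) *
            K.starProjection) ^ N) Z.currentClass⟫_ℝ| ≤
        ‖Z.currentClass‖ ^ 2 * (8 * C * δ / g ^ 2) := by
    intro s hs
    obtain ⟨hS, hle⟩ := hsumA s hs
    have hpt : ∀ N : ℕ, |D.currentCorrelation Z.μ (N * (1 / T ^ 2) + s) - ⟪Z.currentClass,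
        (K.starProjection * (Z.koopman s : ZeroWavenumberSpace Z →L[ℝ] ZeroWavenumberSpace Z) * K.starProjection *
          (K.starProjection * (Z.koopman (1 / T ^ 2) : ZeroWavenumberSpace Z →L[ℝ] ZeroWavenumberSpace Z) *
            K.starProjection) ^ N) Z.currentClass⟫_ℝ| ≤
        ‖Z.currentClass‖ ^ 2 * ‖K.starProjection * (Z.koopman (N * (1 / T ^ 2) + s) : ZeroWavenumberSpace Z →L[ℝ] ZeroWavenumberSpace Z) *
          K.starProjection -
        K.starProjection * (Z.koopman s : ZeroWavenumberSpace Z →L[ℝ] ZeroWavenumberSpace Z) * K.starProjection *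
          (K.starProjection * (Z.koopman (1 / T ^ 2) : ZeroWavenumberSpace Z →L[ℝ] ZeroWavenumberSpace Z) *
            K.starProjection) ^ N‖ := by
      intro N
      rw [hCf, ← inner_sub_right]
      exact hme (_ - _)
    have hS' := hS.mul_left (‖Z.currentClass‖ ^ 2)
    have hS0 : Summable (fun N : ℕ => |D.currentCorrelation Z.μ (N * (1 / T ^ 2) + s) - ⟪Z.currentClass,
        (K.starProjection * (Z.koopman s : ZeroWavenumberSpace Z →L[ℝ] ZeroWavenumberSpace Z) * K.starProjection *
          (K.starProjection * (Z.koopman (1 / T ^ 2) : ZeroWavenumberSpace Z →L[ℝ] ZeroWavenumberSpace Z) *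
            K.starProjection) ^ N) Z.currentClass⟫_ℝ|) :=
      Summable.of_nonneg_of_le (fun N => abs_nonneg _) hpt hS'
    refine ⟨hS0, ?_⟩
    calc ∑' N : ℕ, |D.currentCorrelation Z.μ (N * (1 / T ^ 2) + s) - ⟪Z.currentClass,
        (K.starProjection * (Z.koopman s : ZeroWavenumberSpace Z →L[ℝ] ZeroWavenumberSpace Z) * K.starProjection *
          (K.starProjection * (Z.koopman (1 / T ^ 2) : ZeroWavenumberSpace Z →L[ℝ] ZeroWavenumberSpace Z) *
            K.starProjection) ^ N) Z.currentClass⟫_ℝ|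
        ≤ ∑' N : ℕ, ‖Z.currentClass‖ ^ 2 * ‖K.starProjection * (Z.koopman (N * (1 / T ^ 2) + s) : ZeroWavenumberSpace Z →L[ℝ] ZeroWavenumberSpace Z) *
          K.starProjection -
        K.starProjection * (Z.koopman s : ZeroWavenumberSpace Z →L[ℝ] ZeroWavenumberSpace Z) * K.starProjection *
          (K.starProjection * (Z.koopman (1 / T ^ 2) : ZeroWavenumberSpace Z →L[ℝ] ZeroWavenumberSpace Z) *
            K.starProjection) ^ N‖ := Summable.tsum_le_tsum hpt hS0 hS'
      _ = ‖Z.currentClass‖ ^ 2 * ∑' N : ℕ, ‖K.starProjection * (Z.koopman (N * (1 / T ^ 2) + s) : ZeroWavenumberSpace Z →L[ℝ] ZeroWavenumberSpace Z) *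
          K.starProjection -
        K.starProjection * (Z.koopman s : ZeroWavenumberSpace Z →L[ℝ] ZeroWavenumberSpace Z) * K.starProjection *
          (K.starProjection * (Z.koopman (1 / T ^ 2) : ZeroWavenumberSpace Z →L[ℝ] ZeroWavenumberSpace Z) *
            K.starProjection) ^ N‖ := tsum_mul_left
      _ ≤ ‖Z.currentClass‖ ^ 2 * (8 * C * δ / g ^ 2) := mul_le_mul_of_nonneg_left hle (sq_nonneg _)
  -- (E₃) the main terms: `|⟪J, X T^N J⟫| ≤ ‖J‖² C (1-g)^N`, a geometric series
  have hmain : ∀ s ∈ Set.Ico (0 : ℝ) (1 / T ^ 2),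
      Summable (fun N : ℕ => |⟪Z.currentClass,
        (K.starProjection * (Z.koopman s : ZeroWavenumberSpace Z →L[ℝ] ZeroWavenumberSpace Z) * K.starProjection *
          (K.starProjection * (Z.koopman (1 / T ^ 2) : ZeroWavenumberSpace Z →L[ℝ] ZeroWavenumberSpace Z) *
            K.starProjection) ^ N) Z.currentClass⟫_ℝ|) ∧
      ∑' N : ℕ, |⟪Z.currentClass,
        (K.starProjection * (Z.koopman s : ZeroWavenumberSpace Z →L[ℝ] ZeroWavenumberSpace Z) * K.starProjection *
          (K.starProjection * (Z.koopman (1 / T ^ 2) : ZeroWavenumberSpace Z →L[ℝ] ZeroWavenumberSpace Z) *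
            K.starProjection) ^ N) Z.currentClass⟫_ℝ| ≤ ‖Z.currentClass‖ ^ 2 * (C / g) := by
    intro s hs
    have hgeo : Summable fun N : ℕ => ‖Z.currentClass‖ ^ 2 * (C * (1 - g) ^ N) :=
      ((summable_geometric_of_lt_one (sub_nonneg.2 hg1.le) (by linarith : (1 : ℝ) - g < 1)).mul_left C).mul_left (‖Z.currentClass‖ ^ 2)
    have hpt : ∀ N : ℕ, |⟪Z.currentClass,
        (K.starProjection * (Z.koopman s : ZeroWavenumberSpace Z →L[ℝ] ZeroWavenumberSpace Z) * K.starProjection *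
          (K.starProjection * (Z.koopman (1 / T ^ 2) : ZeroWavenumberSpace Z →L[ℝ] ZeroWavenumberSpace Z) *
            K.starProjection) ^ N) Z.currentClass⟫_ℝ| ≤ ‖Z.currentClass‖ ^ 2 * (C * (1 - g) ^ N) := by
      intro N
      refine (hme _).trans (mul_le_mul_of_nonneg_left ?_ (sq_nonneg _))
      calc ‖K.starProjection * (Z.koopman s : ZeroWavenumberSpace Z →L[ℝ] ZeroWavenumberSpace Z) * K.starProjection *
            (K.starProjection * (Z.koopman (1 / T ^ 2) : ZeroWavenumberSpace Z →L[ℝ] ZeroWavenumberSpace Z) *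
            K.starProjection) ^ N‖
          ≤ ‖K.starProjection * (Z.koopman s : ZeroWavenumberSpace Z →L[ℝ] ZeroWavenumberSpace Z) * K.starProjection‖ *
            ‖(K.starProjection * (Z.koopman (1 / T ^ 2) : ZeroWavenumberSpace Z →L[ℝ] ZeroWavenumberSpace Z) *
            K.starProjection) ^ N‖ := norm_mul_le _ _
        _ ≤ 1 * (C * (1 - g) ^ N) :=
            mul_le_mul (hXle s) (hdiss N) (norm_nonneg _) zero_le_one
        _ = C * (1 - g) ^ N := one_mul _
    have hS0 : Summable (fun N : ℕ => |⟪Z.currentClass,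
        (K.starProjection * (Z.koopman s : ZeroWavenumberSpace Z →L[ℝ] ZeroWavenumberSpace Z) * K.starProjection *
          (K.starProjection * (Z.koopman (1 / T ^ 2) : ZeroWavenumberSpace Z →L[ℝ] ZeroWavenumberSpace Z) *
            K.starProjection) ^ N) Z.currentClass⟫_ℝ|) :=
      Summable.of_nonneg_of_le (fun N => abs_nonneg _) hpt hgeo
    refine ⟨hS0, ?_⟩
    calc ∑' N : ℕ, |⟪Z.currentClass,
        (K.starProjection * (Z.koopman s : ZeroWavenumberSpace Z →L[ℝ] ZeroWavenumberSpace Z) * K.starProjection *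
          (K.starProjection * (Z.koopman (1 / T ^ 2) : ZeroWavenumberSpace Z →L[ℝ] ZeroWavenumberSpace Z) *
            K.starProjection) ^ N) Z.currentClass⟫_ℝ|
        ≤ ∑' N : ℕ, ‖Z.currentClass‖ ^ 2 * (C * (1 - g) ^ N) := Summable.tsum_le_tsum hpt hS0 hgeo
      _ = ‖Z.currentClass‖ ^ 2 * (C * ∑' N : ℕ, (1 - g) ^ N) := by rw [tsum_mul_left, tsum_mul_left]
      _ = ‖Z.currentClass‖ ^ 2 * (C / g) := by
          rw [tsum_geometric_of_lt_one (sub_nonneg.2 hg1.le) (by linarith : (1 : ℝ) - g < 1), sub_sub_cancel, div_eq_mul_inv]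
  -- (E) lattice-to-continuum: `C_T ∈ L¹(0,∞)` and `∫₀^∞ C_T` is `ν·Etot`-close to the Markov plateau
  obtain ⟨hInt, hclose⟩ := stub_latticeGreenKubo (D.currentCorrelation Z.μ)
      (fun (N : ℕ) (s : ℝ) => ⟪Z.currentClass,
        (K.starProjection * (Z.koopman s : ZeroWavenumberSpace Z →L[ℝ] ZeroWavenumberSpace Z) * K.starProjection *
          (K.starProjection * (Z.koopman (1 / T ^ 2) : ZeroWavenumberSpace Z →L[ℝ] ZeroWavenumberSpace Z) *
            K.starProjection) ^ N) Z.currentClass⟫_ℝ)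
      (1 / T ^ 2) (‖Z.currentClass‖ ^ 2 * (8 * C * δ / g ^ 2)) (‖Z.currentClass‖ ^ 2 * (C / g)) Ptot
      hνpos hcont hmcont herr hmain hplat
  -- positivity of the Green–Kubo integral: plateau `≥ p₀` minus the error budget `≤ p₀/2`
  have hE1 : (1 / T ^ 2) * (‖Z.currentClass‖ ^ 2 * (8 * C * δ / g ^ 2)) ≤ Bp * (8 * C * δ / g ^ 2) := by
    have hJT : (1 / T ^ 2) * ‖Z.currentClass‖ ^ 2 ≤ Bp := by
      rw [one_div, inv_mul_le_iff₀ hT2pos]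
      linarith [hJ2]
    calc (1 / T ^ 2) * (‖Z.currentClass‖ ^ 2 * (8 * C * δ / g ^ 2))
        = ((1 / T ^ 2) * ‖Z.currentClass‖ ^ 2) * (8 * C * δ / g ^ 2) := by ring
      _ ≤ Bp * (8 * C * δ / g ^ 2) := mul_le_mul_of_nonneg_right hJT (by positivity)
  have hE2 : Bp * (8 * C * δ / g ^ 2) ≤ p₀ / 2 := by
    calc Bp * (8 * C * δ / g ^ 2) = (8 * Bp * C / g ^ 2) * δ := by ring
      _ ≤ (8 * Bp * C / g ^ 2) * (p₀ * g ^ 2 / (16 * Bp * C)) :=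
          mul_le_mul_of_nonneg_left hδp (by positivity)
      _ = p₀ / 2 := by
          field_simp
          ring
  have hpos : 0 < ∫ t in Set.Ioi (0 : ℝ), D.currentCorrelation Z.μ t := by
    have h := (abs_le.1 hclose).1
    linarith
  -- Bochner + the integrable-spectral criterion (both LANDED)
  obtain ⟨σ, hσ, hCσ⟩ := Theorems.MourreDissolution.stub_cosineBochner _ hcont heven hpsd
  obtain ⟨σ', hσ', hC', δ', gd, hδ', hg, hg0, hgpos, hres⟩ :=
    Theorems.DrudeDissolution.LineSketch.stub_integrableSpectralCriterion σ _ hσ hCσ hInt hpos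
  exact ⟨Z.μ, D, hG, hP, hA, σ', hσ', hC', δ', gd, hδ', hg, hg0, hgpos, hres⟩

end Summit.AtomisticToContinuum.FouriersLaw.Cruxes.DrudeDissolution.KineticPolymerGasOnTheTimeAxis

end
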